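import Mathlib
import Literature.Probability.LatticeModels.IndependencePolynomial
import Literature.Computability.Complexity.FPRAS
import Literature.Computability.Complexity.ProbabilisticClasses
import Literature.Computability.Complexity.GraphEncodings
import HarnessLib

/-!
# Inapproximability of the hard-core partition function above the tree-uniqueness threshold

Trunk `Literature/Computability/Complexity`, neighbourhood of `FPRAS.lean` / `ApproximateCounting.lean`.
Two results of the Sly–Galanis–Štefankovič–Vigoda programme on the hard-core model (weighted
independent sets) on graphs of maximum degree `Δ`, vendored as named facts (statements, no proof in
the tree), together with the finite vocabulary they are stated in. Reused, not redefined: the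
partition function `Z_G(λ) = Σ_{I independent} λ^{|I|}` is the tree's
`Literature.Probability.LatticeModels.independencePolynomial G λ` and the tree-uniqueness threshold
`λ_c(𝕋_Δ) = (Δ-1)^{Δ-1}/(Δ-2)^Δ` is `Literature.Probability.LatticeModels.hardCoreThreshold Δ`
(both `IndependencePolynomial.lean`; in statements the decidability of adjacency is the classical
instance, as in route PneNP/PhaseTwins, whose inlined sums are reached by
`simp only [independencePolynomial]` and whose inlined threshold is `hardCoreThreshold Δ` verbatim).

* **`NP_eq_RP_of_hardcoreFPRAS`** — Galanis–Štefankovič–Vigoda 2016, Theorem 1 (completing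
  Sly 2010 Thm 1 and Galanis–Ge–Štefankovič–Vigoda–Yang 2011): "Unless `NP = RP`, for the hard-core
  model, for all `Δ ≥ 3`, for all `λ` in the non-uniqueness region of the infinite tree `𝕋_Δ`, there
  does not exist an FPRAS for the partition function at activity `λ` for graphs of maximum degree at
  most `Δ`." Non-uniqueness on `𝕋_Δ` holds iff `λ > λ_c(𝕋_Δ) = (Δ-1)^{Δ-1}/(Δ-2)^Δ` (Kelly 1985,
  quoted in GŠV16 §1) — `hardCoreThreshold Δ`. Tree form: for RATIONAL activities
  `λ = p/q` the partition function is carried by the natural-number counting function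
  `hardcoreCount Δ p q : {0,1}* → ℕ`, `x ↦ q^n · Z_{G_x}(p/q) = Σ_{I independent in G_x} p^{|I|} q^{n-|I|}`
  on codes `x` of graphs `G_x` on `n` vertices with maximum degree `≤ Δ` (`encodingGraph`; `0` off
  the promise — undecodable words and graphs of larger degree, a documented junk value, the same
  inlined function as in route PneNP/PhaseTwins), and "FPRAS" is the tree's `HasFPRAS`
  (`FPRAS.lean`, Dyer–Goldberg–Greenhill–Jerrum with a confidence parameter). Since `q^n` is
  computable exactly in polynomial time, an FPRAS for `Z_{G}(p/q)` and one for `q^n Z_G(p/q)` are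
  the same thing, so the tree form is the printed theorem specialised to rational `λ` (weaker).
  "Unless NP = RP" is rendered as the conclusion `Nondeterministic.NP = RP` of the implication.

* **`slyGadgetReduction`** — Sly's bipartite *phase gadget* and his reduction estimate
  (Sly 2010 §2: construction §2.1, Theorem 2.1, Lemma 2.2). WHERE IT IS PROVED. Sly's Theorem 2.1 for
  the degree-`d` gadget at activity `λ` rests on his Condition 1.2 (a second-moment maximum; the two
  further inequalities of his statement are unnecessary, Galanis–Ge–Štefankovič–Vigoda–Yang §2.4),
  which is established for: `d = 3` and all `λ > λ_c(𝕋_3)` (GGŠVY Lemma 5); `d = 4, 5` and all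
  `λ > λ_c(𝕋_d)` (Galanis–Štefankovič–Vigoda 2016, Lemma 4, whose §6 Lemma 19 is Theorem 2.1 under
  that condition); `d ≥ 6` and `λ_c(𝕋_d) < λ ≤ λ_{1/2}(𝕋_d)`, an interval containing
  `(λ_c(𝕋_d), λ_c(𝕋_{d-1})]` (GGŠVY Lemma 5 / Corollary 6 and the proof of their Theorem 1, §2.4).
  Since `λ_c(𝕋_d)` decreases in `d`, for every `Δ ≥ 3` and every `λ > λ_c(𝕋_Δ)` the LEAST `d ≤ Δ` with
  `λ > λ_c(𝕋_d)` falls under one of these cases — this is exactly the covering by which GGŠVY (proof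
  of Thm 1) and GŠV16 (§6, proof of Thm 1: "Theorem 1 was known to hold for `Δ = 3` and `Δ ≥ 6`
  ([Sly10], [GGŠVY]). Lemma 4 in combination with Theorem 5 prove the cases `Δ = 4, 5`") obtain
  hardness at degree `Δ` from a gadget of maximum degree `d ≤ Δ`. The fact therefore provides, for
  `Δ ≥ 3` and `λ > λ_c(𝕋_Δ)`, a gadget of SOME degree `d` with `3 ≤ d ≤ Δ` and `λ > λ_c(𝕋_d)` (its
  parameters `m`, the bound on `|H|` and the port degrees are those of Sly's degree-`d`
  construction); independently, Sly–Sun 2014 prove the hardness theorem for all `λ > λ_c`.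
  Printed content (Sly 2010, with `d` for the degree):
  - (construction, Sly §2.1 / GŠV §6) for parameters `0 < θ, ψ < 1/8` a random bipartite graph
    `G = G(n, θ, ψ)` with `(2 + o(1)) n` vertices and maximum degree `d`, containing the two sides
    `W⁺, W⁻` (`n` vertices each) of a random bipartite `d`-regular-like core and two sets of
    "ports" `V⁺, V⁻`, the roots of `m = (d-1)^{⌊θ log_{d-1} n⌋}` disjoint `(d-1)`-ary trees on each
    side, of degree `d - 1`;
  - (phase) `Y(σ) = +` iff the independent set `σ` occupies at least as many vertices of `W⁺` as of
    `W⁻` (Sly's tie rule; GŠV break ties towards `−`, immaterial: balanced configurations carry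
    exponentially small mass, GŠV16 Thm 4);
  - (Theorem 2.1 = GŠV Lemma 19) there are constants `θ(λ,d), ψ(λ,d) > 0` such that with
    probability `1 - o(1)` over `G`: `(GpropA)` `P_G(Y = +) ≥ 1/n` and `P_G(Y = −) ≥ 1/n`;
    `(GpropB)` `max_{σ_V} |P_G(σ_V | Y = ±)/Q_V^{±}(σ_V) - 1| ≤ n^{-2θ}`, where `Q_V^{+}`
    (resp. `Q_V^{−}`) makes the port occupations independent Bernoulli with parameter `q⁺`
    (resp. `q⁻`) on `V⁺` and `q⁻` (resp. `q⁺`) on `V⁻`, and `0 < q⁻ < q⁺ < 1` are the occupation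
    probabilities of the root of the infinite `(d-1)`-ary tree under the two extremal
    semi-translation-invariant Gibbs measures (odd/even boundary conditions);
  - (reduction, Sly §2.2) for a graph `H` on `N ≤ n^{θ/4}/(d-1)` vertices, `H^G` is the disjoint
    union `Ĥ^G` of copies `G_x`, `x ∈ V(H)`, plus, for every edge `xy` of `H`, `n^{3θ/4}` new edges
    between `V⁺_x` and `V⁺_y` and `n^{3θ/4}` between `V⁻_x` and `V⁻_y`, "deterministically in such a
    way that no vertex has its degree increased by more than 1" (so `H^G` has maximum degree `d`);
  - (Lemma 2.2) if `G` satisfies `(GpropA)`, `(GpropB)` then for every phase vector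
    `𝒴' ∈ {±}^{V(H)}`: `(phaseProbs)` `Z_{Ĥ^G}(𝒴')/Z_{Ĥ^G} = Π_x P_G(Y = 𝒴'_x) ≥ n^{-n^{θ/4}}` and
    `(cutProb)` `Z_{H^G}(𝒴') = (1 + o(1)) · C_H · B^{n^{3θ/4} Cut(𝒴')} · Z_{Ĥ^G}(𝒴')` with
    `C_H = ((1-(q⁺)²)(1-(q⁻)²))^{n^{3θ/4} |E(H)|}`, `B = (1-q⁺q⁻)²/((1-(q⁺)²)(1-(q⁻)²))` and
    `Cut(𝒴') = #{xy ∈ E(H) : 𝒴'_x ≠ 𝒴'_y}`; moreover `B > 1` because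
    `(1-q⁺q⁻)² - (1-(q⁺)²)(1-(q⁻)²) = (q⁺-q⁻)² > 0` (Sly, proof of Thm 1).
  Tree form (one `Prop`, DERANDOMISED and with the tree constants EXISTENTIAL — both weakenings of
  the printed statements): for `Δ ≥ 3` and real `λ > λ_c(𝕋_Δ)` there are a degree `d`,
  `3 ≤ d ≤ Δ`, with `λ > λ_c(𝕋_d)`, a `θ ∈ (0, 1/8)` and reals `0 < q⁻ < q⁺ < 1` such that for every
  `ε > 0` and all large `n` there EXISTS a gadget — a graph `G` on `Fin v`, `v ≤ 3n`, of maximum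
  degree `≤ d`, with `W⁺, W⁻ : Finset (Fin v)` and port embeddings `V⁺, V⁻ : Fin m ↪ Fin v`
  (`m = slyM d θ n`) with disjoint ranges and port degrees `≤ d - 1` — satisfying `(GpropA)`,
  `(GpropB)` and, for every `N ≤ n^{θ/4}/(d-1)`, every graph `H`
  on `Fin N`, EVERY injective port assignment `ι : Fin N × Fin κ ↪ Fin m` (`κ = slyK θ n =
  ⌊n^{3θ/4}⌋₊`; Sly's "this can be done deterministically in such a way that …" — his proof of
  Lemma 2.2 uses only that distinct new edges use distinct ports, which is what `gadgetSubst` builds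
  in) and every `𝒴'`, the two estimates `(phaseProbs)` (the inequality) and `(cutProb)` with
  `1 + o(1)` replaced by a factor in `[1 - ε, 1 + ε]`. Probabilities are written as ratios of
  restricted partition functions (`hardcoreZOn`) and cleared of denominators.

* PROVED consequences and API: `sum_hardcoreZOn_fiber` (`Z = Σ_{𝒴'} Z(𝒴')`), `one_lt_slyB`
  (`B > 1`), `eventually_mul_rpow_rpow_le_slyB_pow` (`3M n^{n^{θ/4}} ≤ B^{κ}` eventually),
  **`slyGadgetReduction.twins`** — what route PneNP/PhaseTwins consumes: two graphs `H₀, H₁` on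
  the same vertex set with equally many edges and `maxcut(H₁) < maxcut(H₀)` give
  `Z(H₀^G) ≥ M · Z(H₁^G)` for any prescribed `M` once `n` is large (Sly's proof of Thm 1 run for two
  graphs sharing `Ĥ^G`) —, `maxDegree_gadgetSubst_le` (`H^G` has maximum degree `≤ d`, for every `H`),
  `mul_slyK_le_slyM` / `portReservation` (the `N κ ≤ m` ports needed exist when
  `N ≤ n^{θ/4}/(d-1)`), and `hardcoreCount_encode_eq_mul_independencePolynomial` (`N(x) = q^n Z_G(p/q)`).

* PROVED, **Sly's Lemma 2.2** (`slyCutEstimate_of_slyProps`, last section): for `n ≥ n₀(θ, ε)`, ANY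
  gadget with `(GpropA)` and `(GpropB)` (`δ = n^{-2θ}`) satisfies `SlyCutEstimate` (relative error `ε`)
  for every `N ≤ n^{θ/4}`, `κ`, `H`, `ι`, `𝒴'`; hence (`slyGadgetReduction_of_gadgets`) the bundled fact
  `slyGadgetReduction` reduces to the derandomised content of Sly's Theorem 2.1 (the random gadget),
  which remains unproved in the tree.

## What is NOT here

The random graph `G(n, θ, ψ)` itself, Gibbs measures on infinite trees (the constants `q^{±}` are
only asserted to exist with `0 < q⁻ < q⁺ < 1`, which is all Sly's reduction uses), the sampling-to-
counting equivalence and the `RP` machine of the proof of Theorem 1, the antiferromagnetic Ising /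
general antiferromagnetic 2-spin versions (GŠV16 Thms 2, 3), Sly–Sun 2014.

## References

* A. Galanis, D. Štefankovič, E. Vigoda, *Inapproximability of the partition function for the
  antiferromagnetic Ising and hard-core models*, Combin. Probab. Comput. 25 (2016) 500–559,
  arXiv:1203.2226: Thm 1 (p. 4 of the arXiv version), §6 (gadget, Lemma 19, proof of Thm 1,
  proof sketch §6.3) [GalanisStefankovicVigoda2016].
* A. Sly, *Computational transition at the uniqueness threshold*, FOCS 2010, 287–296,
  arXiv:1005.5584: Thm 1, §2.1 (construction of `G`, phase, `Q_V^{±}`, Thm 2.1), §2.2 (the graph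
  `H^G`, Lemma 2.2, proof of Thm 1) [Sly2010].
* A. Galanis, Q. Ge, D. Štefankovič, E. Vigoda, L. Yang, *Improved inapproximability results for
  counting independent sets in the hard-core model*, Random Structures Algorithms 45 (2014) 78–110,
  arXiv:1105.5131: Thm 1, Lemma 5, Cor. 6, §2.4 (proof of Thm 1; Sly's extra conditions removed)
  [GalanisEtAl2012].
* H. Peters, G. Regts, Michigan Math. J. 68 (2019), §1 (`λ_c(Δ)`, via `IndependencePolynomial.lean`)
  [PetersRegts2019].
* A. Sly, N. Sun, *Counting in two-spin models on d-regular graphs*, Ann. Probab. 42 (2014)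
  [SlySun2014].
* M. Dyer, L. A. Goldberg, C. Greenhill, M. Jerrum, Algorithmica 38 (2003), §1 (FPRAS) [DyerEtAl2003].
-/

namespace Literature.Computability.Complexity

open Finset
open _root_.Computability
open Literature.Probability.LatticeModels

/-! ### The hard-core partition function of a finite graph -/

section HardcoreZ

variable {V : Type*} [Fintype V] [DecidableEq V]

/-! The partition function itself is the tree's
`Literature.Probability.LatticeModels.independencePolynomial G lam = ∑ I, if G.IsIndepSet ↑I then lam ^ #I else 0`
(`IndependencePolynomial.lean`; Sly's `Z`, "the probability distribution over independent sets `I` of a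
graph weighted proportionally to `λ^{|I|}`", `Z` its normalising constant). It takes the decidability
of adjacency as an instance argument; in the statements below that instance is the classical one
(`open scoped Classical`), which is also what route PneNP/PhaseTwins' inlined sums elaborate to, so
`simp only [independencePolynomial]` (or `unfold`) turns `independencePolynomial G lam` into the
route's literal `∑ I : Finset (Fin n), if G.IsIndepSet ↑I then lam ^ I.card else 0`. -/

open scoped Classical in
/-- **Restricted hard-core partition function** `Z_G(λ; E) = Σ_{I independent, I ∈ E} λ^{|I|}`: the
total weight of the independent sets in the event `E`; `Z_G(λ; E)/Z_G(λ)` is the Gibbs probability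
`P_G(E)` (Sly 2010 §2: `P_G(Y = +)`, `Z_{H^G}(𝒴')`, …). [cite: Sly2010, §2.2 (definition of `Z_{H^G}(𝒴')`)] -/
noncomputable def hardcoreZOn (G : SimpleGraph V) (lam : ℝ) (E : Finset V → Prop) : ℝ :=
  ∑ I : Finset V, if G.IsIndepSet (↑I : Set V) ∧ E I then lam ^ I.card else 0

open scoped Classical in
/-- Unfolding lemma for `hardcoreZOn`. [folklore] -/
theorem hardcoreZOn_def (G : SimpleGraph V) (lam : ℝ) (E : Finset V → Prop) :
    hardcoreZOn G lam E =
      ∑ I : Finset V, if G.IsIndepSet (↑I : Set V) ∧ E I then lam ^ I.card else 0 := rfl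

open scoped Classical in
/-- The restricted partition function of the sure event is the partition function
(`independencePolynomial`, classical decidability of adjacency). [folklore] -/
theorem hardcoreZOn_true (G : SimpleGraph V) (lam : ℝ) :
    hardcoreZOn G lam (fun _ => True) = independencePolynomial G lam := by
  rw [hardcoreZOn_def, independencePolynomial]
  refine Finset.sum_congr rfl fun I _ => ?_
  by_cases hI : G.IsIndepSet (↑I : Set V) <;> simp [hI]

/-- Restricted partition functions are nonnegative for `λ ≥ 0`. [folklore] -/
theorem hardcoreZOn_nonneg (G : SimpleGraph V) {lam : ℝ} (hlam : 0 ≤ lam) (E : Finset V → Prop) :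
    0 ≤ hardcoreZOn G lam E := by
  classical
  rw [hardcoreZOn_def]
  exact Finset.sum_nonneg fun I _ => by split_ifs <;> positivity

/-- Monotonicity of the restricted partition function in the event, for `λ ≥ 0`. [folklore] -/
theorem hardcoreZOn_mono (G : SimpleGraph V) {lam : ℝ} (hlam : 0 ≤ lam) {E E' : Finset V → Prop}
    (h : ∀ I, E I → E' I) : hardcoreZOn G lam E ≤ hardcoreZOn G lam E' := by
  classical
  rw [hardcoreZOn_def, hardcoreZOn_def]
  refine Finset.sum_le_sum fun I _ => ?_
  by_cases hI : G.IsIndepSet (↑I : Set V) ∧ E I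
  · rw [if_pos hI, if_pos ⟨hI.1, h I hI.2⟩]
  · rw [if_neg hI]
    split_ifs <;> positivity

open scoped Classical in
/-- A restricted partition function is at most the partition function (`λ ≥ 0`). [folklore] -/
theorem hardcoreZOn_le_independencePolynomial (G : SimpleGraph V) {lam : ℝ} (hlam : 0 ≤ lam)
    (E : Finset V → Prop) : hardcoreZOn G lam E ≤ independencePolynomial G lam := by
  rw [← hardcoreZOn_true]
  exact hardcoreZOn_mono G hlam fun _ _ => trivial

open scoped Classical in
/-- `Z_G(λ; E) + Z_G(λ; ¬E) = Z_G(λ)`: restricted partition functions of complementary events add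
up. [folklore] -/
theorem hardcoreZOn_add_not (G : SimpleGraph V) (lam : ℝ) (E : Finset V → Prop) :
    hardcoreZOn G lam E + hardcoreZOn G lam (fun I => ¬ E I) = independencePolynomial G lam := by
  rw [hardcoreZOn_def, hardcoreZOn_def, independencePolynomial, ← Finset.sum_add_distrib]
  refine Finset.sum_congr rfl fun I _ => ?_
  by_cases hI : G.IsIndepSet (↑I : Set V) <;> by_cases hE : E I <;> simp [hI, hE]

end HardcoreZ

/-! ### The counting function on code words

The tree-uniqueness threshold `λ_c(𝕋_Δ) = (Δ-1)^{Δ-1}/(Δ-2)^Δ` (Kelly 1985: non-uniqueness on `𝕋_Δ`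
iff `λ > λ_c(𝕋_Δ)`, GŠV16 §1) is the tree's `Literature.Probability.LatticeModels.hardCoreThreshold Δ`
(`IndependencePolynomial.lean`; the same term as `hardCoreCriticalActivity` of
`BISHardnessBoundedDegree.lean` and as the threshold inlined in route PneNP/PhaseTwins). -/

open scoped Classical in
/-- **The hard-core counting function at a rational activity `p/q`, on code words**: for the code
`x` of a graph `G_x = ⟨n, G⟩` (`encodingGraph`) of maximum degree `≤ Δ`,
`N(x) = Σ_{I independent in G} p^{|I|} q^{n-|I|} = q^n · Z_G(p/q) ∈ ℕ`; `0` on undecodable words and on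
graphs of maximum degree `> Δ` (junk value off the promise; the promise is decidable in polynomial
time, so an approximator loses nothing). This is, verbatim, the function inlined in the target and
the top crux of route PneNP/PhaseTwins. "FPRAS for the partition function at activity `λ = p/q` for
graphs of maximum degree at most `Δ`" (GŠV16 Thm 1) is `HasFPRAS (hardcoreCount Δ p q)`.
[cite: GalanisStefankovicVigoda2016, Thm 1 (the approximation problem)] -/
noncomputable def hardcoreCount (Δ p q : ℕ) : List Bool → ℕ := fun x =>
  match encodingGraph.decode x with
  | none => 0
  | some G =>
    if G.2.maxDegree ≤ Δ then
      ∑ I : Finset (Fin G.1),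
        (if G.2.IsIndepSet (↑I : Set (Fin G.1)) then p ^ I.card * q ^ (G.1 - I.card) else 0)
    else 0

open scoped Classical in
/-- `hardcoreCount` on the code of a graph of maximum degree `≤ Δ`. [folklore] -/
theorem hardcoreCount_encode_of_maxDegree_le (Δ p q : ℕ) {n : ℕ} (G : SimpleGraph (Fin n))
    (hG : G.maxDegree ≤ Δ) :
    hardcoreCount Δ p q (encodingGraph.encode ⟨n, G⟩) =
      ∑ I : Finset (Fin n), (if G.IsIndepSet (↑I : Set (Fin n)) then p ^ I.card * q ^ (n - I.card) else 0) := by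
  simp only [hardcoreCount, encodingGraph.decode_encode]
  rw [if_pos hG]

open scoped Classical in
/-- `hardcoreCount` vanishes on the code of a graph of maximum degree `> Δ` (off the promise). [folklore] -/
theorem hardcoreCount_encode_of_lt_maxDegree (Δ p q : ℕ) {n : ℕ} (G : SimpleGraph (Fin n))
    (hG : Δ < G.maxDegree) : hardcoreCount Δ p q (encodingGraph.encode ⟨n, G⟩) = 0 := by
  simp only [hardcoreCount, encodingGraph.decode_encode]
  rw [if_neg (not_le.2 hG)]

open scoped Classical in
/-- **`N(x) = q^n · Z_G(p/q)`**: on the code of a graph `G` on `n` vertices of maximum degree `≤ Δ`,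
the counting function is `q^n` times the partition function (`independencePolynomial`, classical
decidability) at activity `p/q` (`q > 0`). [folklore] -/
theorem hardcoreCount_encode_eq_mul_independencePolynomial (Δ p q : ℕ) (hq : 0 < q) {n : ℕ}
    (G : SimpleGraph (Fin n)) (hG : G.maxDegree ≤ Δ) :
    (hardcoreCount Δ p q (encodingGraph.encode ⟨n, G⟩) : ℝ) =
      (q : ℝ) ^ n * independencePolynomial G ((p : ℝ) / q) := by
  rw [hardcoreCount_encode_of_maxDegree_le Δ p q G hG, independencePolynomial, Finset.mul_sum]
  push_cast
  refine Finset.sum_congr rfl fun I _ => ?_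
  split_ifs
  · have hqne : (q : ℝ) ≠ 0 := by exact_mod_cast hq.ne'
    have hIn : I.card ≤ n := by simpa using I.card_le_univ
    rw [div_pow, mul_div_assoc', eq_div_iff (pow_ne_zero _ hqne)]
    rw [mul_assoc, ← pow_add, Nat.sub_add_cancel hIn, mul_comm]
  · simp

/-! ### Theorem 1 of Galanis–Štefankovič–Vigoda -/

/-- **Galanis–Štefankovič–Vigoda 2016, Theorem 1** (hard-core model; the cases `Δ = 3` and `Δ ≥ 6`
are Sly 2010 / Galanis–Ge–Štefankovič–Vigoda–Yang 2011, `Δ = 4, 5` are new there): "Unless `NP = RP`,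
for the hard-core model, for all `Δ ≥ 3`, for all `λ` in the non-uniqueness region of the infinite
tree `𝕋_Δ`" — i.e. `λ > λ_c(𝕋_Δ) = (Δ-1)^{Δ-1}/(Δ-2)^Δ`, `hardCoreThreshold` — "there does not
exist an FPRAS for the partition function at activity `λ` for graphs of maximum degree at most `Δ`."
Tree form, for rational activities `λ = p/q` (a specialisation): an FPRAS (`HasFPRAS`, with confidence
parameter; equivalent to the `3/4` form by Jerrum–Valiant–Vazirani powering) for the counting function
`hardcoreCount Δ p q = q^n · Z_{G_x}(p/q)` forces `NP = RP` (with the tree's `Nondeterministic.NP` and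
`RP = rp P`). The proof (not in the tree) is Sly's randomised reduction from MAX-CUT on the graphs
`H^G` of `slyGadgetReduction`, via the equivalence of approximate counting and sampling for this
self-reducible problem. Stated as a `Prop`.
[cite: GalanisStefankovicVigoda2016, Thm 1] -/
def NP_eq_RP_of_hardcoreFPRAS : Prop :=
  ∀ Δ p q : ℕ, 3 ≤ Δ → 0 < q → hardCoreThreshold Δ < (p : ℝ) / q →
    HasFPRAS (hardcoreCount Δ p q) → Nondeterministic.NP = RP

/-- Contrapositive reading of `NP_eq_RP_of_hardcoreFPRAS`: if `NP ≠ RP` then above the uniqueness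
threshold the hard-core counting function has no FPRAS, for every `Δ ≥ 3` and every rational
activity. [cite: GalanisStefankovicVigoda2016, Thm 1] -/
theorem NP_eq_RP_of_hardcoreFPRAS.not_hasFPRAS (h : NP_eq_RP_of_hardcoreFPRAS)
    (hNP : Nondeterministic.NP ≠ RP) {Δ p q : ℕ} (hΔ : 3 ≤ Δ) (hq : 0 < q)
    (hlam : hardCoreThreshold Δ < (p : ℝ) / q) : ¬ HasFPRAS (hardcoreCount Δ p q) :=
  fun hF => hNP (h Δ p q hΔ hq hlam hF)


/-! ### Sly's phase gadget and the substituted graph `H^G`: vocabulary -/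

section Gadget

variable {V : Type*}

/-- **The phase of a configuration** (Sly 2010 §2.1): for the two distinguished vertex sets `W⁺, W⁻`
of the gadget, the phase `Y(σ)` of an independent set `σ` is `+` (here `true`) if `σ` occupies at least
as many vertices of `W⁺` as of `W⁻` ("`Y = +1` if `Σ_{w ∈ W⁺} σ_w ≥ Σ_{w ∈ W⁻} σ_w`, `-1` otherwise"),
and `−` (`false`) otherwise. (GŠV16 §6 break the tie the other way; immaterial there.)
[cite: Sly2010, §2.1 (definition of the phase `Y`)] -/
def slyPhase [DecidableEq V] (Wp Wm : Finset V) (I : Finset V) : Bool :=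
  decide ((I ∩ Wm).card ≤ (I ∩ Wp).card)

/-- **The configuration on the ports**: for port embeddings `V⁺, V⁻ : Fin m ↪ V` and a vertex set
`I`, the pair (occupied `+`-ports, occupied `−`-ports) — Sly's `σ_V`, the restriction of `σ` to
`V = V⁺ ∪ V⁻`. [cite: Sly2010, §2.1 (configurations `σ_V` on `V = V⁺ ∪ V⁻`)] -/
def portPattern [DecidableEq V] {m : ℕ} (Vp Vm : Fin m ↪ V) (I : Finset V) :
    Finset (Fin m) × Finset (Fin m) :=
  (Finset.univ.filter fun i => Vp i ∈ I, Finset.univ.filter fun i => Vm i ∈ I)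

/-- **The product measures `Q_V^{±}`** (Sly 2010 §2.1): `portLaw a b m (S⁺, S⁻) =
a^{|S⁺|} (1-a)^{m-|S⁺|} · b^{|S⁻|} (1-b)^{m-|S⁻|}`, the probability of the port configuration `(S⁺, S⁻)`
when the `m` ports of `V⁺` are occupied independently with probability `a` and those of `V⁻` with
probability `b`; `Q_V^{+} = portLaw q⁺ q⁻ m` and `Q_V^{−} = portLaw q⁻ q⁺ m` ("the spins are iid
Bernoulli with probability `q⁺` (resp. `q⁻`) on `V⁺` and `q⁻` (resp. `q⁺`) on `V⁻`").
[cite: Sly2010, §2.1 (definition of `Q_V^{±}`)] -/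
noncomputable def portLaw (a b : ℝ) (m : ℕ) (S : Finset (Fin m) × Finset (Fin m)) : ℝ :=
  a ^ S.1.card * (1 - a) ^ (m - S.1.card) * (b ^ S.2.card * (1 - b) ^ (m - S.2.card))

/-- **Sly's substituted graph `H^G`** (Sly 2010 §2.2), with an explicit port assignment. Vertices
`(x, a)`, `x ∈ V(H) = Fin N`, `a ∈ V(G)`: "take the graph comprising `|H|` disconnected copies of `G`
and identify each copy with a vertex in `H`" — `(x, a) ∼ (x, b)` iff `a ∼_G b` — "for every edge
`(x, y)` in the graph `H` add `κ = n^{3θ/4}` edges between `V⁺_x` and `V⁺_y` and similarly add `κ`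
edges between `V⁻_x` and `V⁻_y` … in such a way that no vertex has its degree increased by more
than 1": here the `j`-th new `+`-edge of `xy` joins the port `V⁺(ι(y, j))` of copy `x` (the port of
`G_x` reserved for the neighbour `y`, `j`-th parallel edge) to the port `V⁺(ι(x, j))` of copy `y`, and
likewise for `V⁻`, for an injective reservation map `ι : Fin N × Fin κ ↪ Fin m`; a port `V^{±}(ι(y,j))`
of copy `x` receives a new edge iff `xy ∈ E(H)`, and then exactly one. With `H = ⊥` this is the
disjoint union `Ĥ^G` of the copies. [cite: Sly2010, §2.2 (construction of `H^G`)] -/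
def gadgetSubst {N κ m : ℕ} (H : SimpleGraph (Fin N)) (G : SimpleGraph V) (Vp Vm : Fin m ↪ V)
    (ι : Fin N × Fin κ ↪ Fin m) : SimpleGraph (Fin N × V) where
  Adj a b := (a.1 = b.1 ∧ G.Adj a.2 b.2) ∨
    (H.Adj a.1 b.1 ∧ ∃ j : Fin κ,
      (a.2 = Vp (ι (b.1, j)) ∧ b.2 = Vp (ι (a.1, j))) ∨ (a.2 = Vm (ι (b.1, j)) ∧ b.2 = Vm (ι (a.1, j))))
  symm.symm a b h := by
    rcases h with ⟨h1, h2⟩ | ⟨h1, j, hj⟩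
    · exact Or.inl ⟨h1.symm, h2.symm⟩
    · refine Or.inr ⟨h1.symm, j, ?_⟩
      rcases hj with ⟨ha, hb⟩ | ⟨ha, hb⟩
      · exact Or.inl ⟨hb, ha⟩
      · exact Or.inr ⟨hb, ha⟩
  loopless.irrefl a h := by
    rcases h with ⟨_, h2⟩ | ⟨h1, _⟩
    · exact G.irrefl h2
    · exact H.irrefl h1

/-- Unfolding lemma for the adjacency of `gadgetSubst`. [folklore] -/
theorem gadgetSubst_adj {N κ m : ℕ} (H : SimpleGraph (Fin N)) (G : SimpleGraph V) (Vp Vm : Fin m ↪ V)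
    (ι : Fin N × Fin κ ↪ Fin m) (a b : Fin N × V) :
    (gadgetSubst H G Vp Vm ι).Adj a b ↔
      (a.1 = b.1 ∧ G.Adj a.2 b.2) ∨
        (H.Adj a.1 b.1 ∧ ∃ j : Fin κ,
          (a.2 = Vp (ι (b.1, j)) ∧ b.2 = Vp (ι (a.1, j))) ∨
            (a.2 = Vm (ι (b.1, j)) ∧ b.2 = Vm (ι (a.1, j)))) :=
  Iff.rfl

/-- With `H = ⊥` (no edges) the substituted graph is the disjoint union of the copies: `(x, a) ∼ (y, b)`
iff `x = y` and `a ∼_G b`. [cite: Sly2010, §2.2 (the graph `Ĥ^G`)] -/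
theorem gadgetSubst_bot_adj {N κ m : ℕ} (G : SimpleGraph V) (Vp Vm : Fin m ↪ V)
    (ι : Fin N × Fin κ ↪ Fin m) (a b : Fin N × V) :
    (gadgetSubst ⊥ G Vp Vm ι).Adj a b ↔ a.1 = b.1 ∧ G.Adj a.2 b.2 := by
  simp [gadgetSubst_adj]

/-- Adding the edges of `H` only adds edges to `Ĥ^G`: `Ĥ^G ≤ H^G`. [folklore] -/
theorem gadgetSubst_bot_le {N κ m : ℕ} (H : SimpleGraph (Fin N)) (G : SimpleGraph V) (Vp Vm : Fin m ↪ V)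
    (ι : Fin N × Fin κ ↪ Fin m) : gadgetSubst ⊥ G Vp Vm ι ≤ gadgetSubst H G Vp Vm ι := by
  intro a b h
  rw [gadgetSubst_bot_adj] at h
  exact Or.inl h

/-- **The configuration on the copy `G_x`**: the fibre over `x` of a vertex set of `H^G`. [folklore] -/
def copyFiber [DecidableEq V] {N : ℕ} (I : Finset (Fin N × V)) (x : Fin N) : Finset V :=
  (I.filter fun a => a.1 = x).image Prod.snd

/-- Membership in the fibre. [folklore] -/
theorem mem_copyFiber [DecidableEq V] {N : ℕ} (I : Finset (Fin N × V)) (x : Fin N) (a : V) :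
    a ∈ copyFiber I x ↔ (x, a) ∈ I := by
  simp only [copyFiber, Finset.mem_image, Finset.mem_filter]
  constructor
  · rintro ⟨⟨y, b⟩, ⟨hI, rfl⟩, rfl⟩
    exact hI
  · intro h
    exact ⟨(x, a), ⟨h, rfl⟩, rfl⟩

/-- **The phase vector `𝒴(σ) = (Y_x(σ))_{x ∈ V(H)}`** of a configuration of `H^G`: the phase of its
restriction to each copy `G_x`. [cite: Sly2010, §2.2 (the vector of phases `𝒴`)] -/
def phaseVec [DecidableEq V] {N : ℕ} (Wp Wm : Finset V) (I : Finset (Fin N × V)) : Fin N → Bool :=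
  fun x => slyPhase Wp Wm (copyFiber I x)

end Gadget

open scoped Classical in
/-- **`Cut(𝒴')`**: the number of edges of `H` cut by the two-colouring `𝒴' : V(H) → {±}`,
"`#{(x,y) ∈ E(H) : 𝒴'_x ≠ 𝒴'_y}`", counted once each as the ordered pairs `(x, y)` with `x ∼ y`,
`𝒴'_x = +`, `𝒴'_y = −`. [cite: Sly2010, Lemma 2.2 (definition of `Cut(𝒴')`)] -/
noncomputable def cutSize {N : ℕ} (H : SimpleGraph (Fin N)) (Y : Fin N → Bool) : ℕ :=
  ((Finset.univ : Finset (Fin N × Fin N)).filter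
    fun e => H.Adj e.1 e.2 ∧ Y e.1 = true ∧ Y e.2 = false).card

/-- **`maxcut(H)`**: the largest number of edges of `H` cut by a two-colouring of its vertices
(MAX-CUT, the target of Sly's reduction). [cite: Sly2010, §2.2 (reduction to Max-Cut)] -/
noncomputable def maxCut {N : ℕ} (H : SimpleGraph (Fin N)) : ℕ :=
  Finset.univ.sup (cutSize H)

/-- Every cut is at most the maximum cut. [folklore] -/
theorem cutSize_le_maxCut {N : ℕ} (H : SimpleGraph (Fin N)) (Y : Fin N → Bool) :
    cutSize H Y ≤ maxCut H :=
  Finset.le_sup (f := cutSize H) (Finset.mem_univ Y)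

/-- The maximum cut is attained. [folklore] -/
theorem exists_cutSize_eq_maxCut {N : ℕ} (H : SimpleGraph (Fin N)) : ∃ Y, cutSize H Y = maxCut H := by
  obtain ⟨Y, -, hY⟩ := Finset.exists_mem_eq_sup (Finset.univ : Finset (Fin N → Bool))
    Finset.univ_nonempty (cutSize H)
  exact ⟨Y, hY.symm⟩

/-- **`m = (Δ-1)^{⌊θ log_{Δ-1} n⌋}`**: the number of ports on each side of Sly's gadget `G(n, θ, ψ)`
(the roots `V⁺`, resp. `V⁻`, of the appended `(Δ-1)`-ary trees).
[cite: Sly2010, §2.1 (construction of `G`, the number `m`)] -/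
noncomputable def slyM (Δ : ℕ) (θ : ℝ) (n : ℕ) : ℕ :=
  (Δ - 1) ^ ⌊θ * Real.logb ((Δ : ℝ) - 1) n⌋₊

/-- **`κ = n^{3θ/4}`** (integer part): the number of new edges Sly adds between `V⁺_x` and `V⁺_y`
(and between `V⁻_x` and `V⁻_y`) for each edge `xy` of `H`. [cite: Sly2010, §2.2 (construction of `H^G`)] -/
noncomputable def slyK (θ : ℝ) (n : ℕ) : ℕ :=
  ⌊(n : ℝ) ^ (3 * θ / 4)⌋₊

/-- **Sly's base `B = (1-q⁺q⁻)²/((1-(q⁺)²)(1-(q⁻)²))`**, the gain of a cut edge of `H` over an uncut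
one per pair of new edges in `H^G`; `B > 1` since `(1-q⁺q⁻)² - (1-(q⁺)²)(1-(q⁻)²) = (q⁺-q⁻)²`
(`one_lt_slyB`). [cite: Sly2010, Lemma 2.2 (second display) and proof of Thm 1] -/
noncomputable def slyB (qp qm : ℝ) : ℝ :=
  (1 - qp * qm) ^ 2 / ((1 - qp ^ 2) * (1 - qm ^ 2))

/-- **Sly's constant `C_H = ((1-(q⁺)²)(1-(q⁻)²))^{κ |E(H)|}`** (it depends on `H` only through its
number of edges `E`). [cite: Sly2010, Lemma 2.2 (the constant `C_H`)] -/
noncomputable def slyC (qp qm : ℝ) (κ E : ℕ) : ℝ :=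
  ((1 - qp ^ 2) * (1 - qm ^ 2)) ^ (κ * E)

/-- `B > 1` for `0 < q⁻ < q⁺ < 1`: `(1-q⁺q⁻)² - (1-(q⁺)²)(1-(q⁻)²) = (q⁺-q⁻)² > 0` and the
denominator is positive. [cite: Sly2010, proof of Thm 1 (§2.2)] -/
theorem one_lt_slyB {qp qm : ℝ} (hqm : 0 < qm) (hlt : qm < qp) (hqp : qp < 1) : 1 < slyB qp qm := by
  unfold slyB
  have h1 : 0 < 1 - qp ^ 2 := by nlinarith
  have h2 : 0 < 1 - qm ^ 2 := by nlinarith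
  rw [one_lt_div (mul_pos h1 h2)]
  nlinarith [sq_pos_of_pos (sub_pos.2 hlt)]

/-- `C_H > 0` for `q⁺, q⁻ ∈ (0, 1)`. [folklore] -/
theorem slyC_pos {qp qm : ℝ} (hqm : 0 < qm) (hlt : qm < qp) (hqp : qp < 1) (κ E : ℕ) :
    0 < slyC qp qm κ E := by
  unfold slyC
  have h1 : 0 < 1 - qp ^ 2 := by nlinarith
  have h2 : 0 < 1 - qm ^ 2 := by nlinarith
  positivity

section GadgetProps

variable {V : Type*} [Fintype V] [DecidableEq V]

open scoped Classical in
/-- **Property (GpropA) of Sly's Theorem 2.1** ("the phases occur with roughly balanced probability"):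
`P_G(Y = +) ≥ 1/n` and `P_G(Y = −) ≥ 1/n`, i.e. `Z_G(λ; Y = ±) ≥ Z_G(λ)/n`
(`Z_G = independencePolynomial G`, classical decidability of adjacency).
[cite: Sly2010, Thm 2.1 (first item); GalanisStefankovicVigoda2016 Lemma 19 (first item)] -/
def SlyPropA (G : SimpleGraph V) (lam : ℝ) (Wp Wm : Finset V) (n : ℕ) : Prop :=
  independencePolynomial G lam / n ≤ hardcoreZOn G lam (fun I => slyPhase Wp Wm I = true) ∧
    independencePolynomial G lam / n ≤ hardcoreZOn G lam (fun I => slyPhase Wp Wm I = false)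

/-- **Property (GpropB) of Sly's Theorem 2.1** ("the conditional distribution of the configuration on
`V` satisfies `max_{σ_V} |P_G(σ_V | Y = ±)/Q_V^{±}(σ_V) - 1| ≤ δ`", `δ = n^{-2θ}`), cleared of
denominators: for each phase `s` and each port configuration `S = (S⁺, S⁻)`,
`|Z_G(λ; Y = s ∧ σ_V = S) - Q_V^{s}(S) · Z_G(λ; Y = s)| ≤ δ · Q_V^{s}(S) · Z_G(λ; Y = s)`, where
`Q_V^{+} = portLaw q⁺ q⁻ m`, `Q_V^{−} = portLaw q⁻ q⁺ m`.
[cite: Sly2010, Thm 2.1 (second item); GalanisStefankovicVigoda2016 Lemma 19 (second item)] -/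
def SlyPropB (G : SimpleGraph V) (lam : ℝ) (Wp Wm : Finset V) {m : ℕ} (Vp Vm : Fin m ↪ V)
    (qp qm δ : ℝ) : Prop :=
  ∀ (s : Bool) (S : Finset (Fin m) × Finset (Fin m)),
    |hardcoreZOn G lam (fun I => slyPhase Wp Wm I = s ∧ portPattern Vp Vm I = S) -
        portLaw (if s then qp else qm) (if s then qm else qp) m S *
          hardcoreZOn G lam (fun I => slyPhase Wp Wm I = s)| ≤
      δ * (portLaw (if s then qp else qm) (if s then qm else qp) m S *
        hardcoreZOn G lam (fun I => slyPhase Wp Wm I = s))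

open scoped Classical in
/-- **The conclusions of Sly's Lemma 2.2** for the gadget `(G, W^{±}, V^{±})`, graphs `H` on `Fin N`,
`κ` new edges per edge of `H` and side, and EVERY injective port reservation `ι` (Sly's proof uses
only that distinct new edges use distinct ports): for every phase vector `𝒴'`,
`(phaseProbs)` `Z_{Ĥ^G}(λ; 𝒴 = 𝒴') ≥ n^{-n^{θ/4}} · Z_{Ĥ^G}(λ)` (the printed
`Z_{Ĥ^G}(𝒴')/Z_{Ĥ^G} = Π_x P_G(Y = 𝒴'_x) ≥ n^{-n^{θ/4}}`), and `(cutProb)`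
`|Z_{H^G}(λ; 𝒴 = 𝒴') - C_H B^{κ Cut(𝒴')} Z_{Ĥ^G}(λ; 𝒴 = 𝒴')| ≤ ε · C_H B^{κ Cut(𝒴')} Z_{Ĥ^G}(λ; 𝒴 = 𝒴')`
(the printed `Z_{H^G}(𝒴')/Z_{Ĥ^G}(𝒴') = (C_H + o(1)) B^{κ Cut(𝒴')}`, whose proof gives the relative
error `1 + o(1)`, uniformly in `H` and `𝒴'`: `2|E(H)| ≤ n^{θ/2}` factors `1 + O(n^{-θ})`), with
`Ĥ^G = gadgetSubst ⊥ …`, `H^G = gadgetSubst H …`, `C_H = slyC q⁺ q⁻ κ |E(H)|`, `B = slyB q⁺ q⁻`.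
[cite: Sly2010, Lemma 2.2 (the two displayed estimates)] -/
def SlyCutEstimate (G : SimpleGraph V) (lam : ℝ) (Wp Wm : Finset V) {m : ℕ} (Vp Vm : Fin m ↪ V)
    (qp qm ε : ℝ) (n : ℕ) (θ : ℝ) (N κ : ℕ) : Prop :=
  ∀ (ι : Fin N × Fin κ ↪ Fin m) (H : SimpleGraph (Fin N)) (Y : Fin N → Bool),
    (n : ℝ) ^ (-((n : ℝ) ^ (θ / 4))) * independencePolynomial (gadgetSubst ⊥ G Vp Vm ι) lam ≤
        hardcoreZOn (gadgetSubst ⊥ G Vp Vm ι) lam (fun I => phaseVec Wp Wm I = Y) ∧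
      |hardcoreZOn (gadgetSubst H G Vp Vm ι) lam (fun I => phaseVec Wp Wm I = Y) -
          slyC qp qm κ H.edgeFinset.card * slyB qp qm ^ (κ * cutSize H Y) *
            hardcoreZOn (gadgetSubst ⊥ G Vp Vm ι) lam (fun I => phaseVec Wp Wm I = Y)| ≤
        ε * (slyC qp qm κ H.edgeFinset.card * slyB qp qm ^ (κ * cutSize H Y) *
          hardcoreZOn (gadgetSubst ⊥ G Vp Vm ι) lam (fun I => phaseVec Wp Wm I = Y))

end GadgetProps

/-! ### Sly's gadget theorem and reduction estimate (Sly 2010 Thm 2.1 + Lemma 2.2; GŠV16 Lemma 19) -/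

open scoped Classical in
/-- **Sly's phase gadget above the uniqueness threshold** (Sly 2010, Theorem 2.1 with Lemma 2.2),
derandomised, with the tree constants made existential, and with the gadget's degree `d ≤ Δ`
existential: for every `Δ ≥ 3` and every real `λ > λ_c(𝕋_Δ)` (`hardCoreThreshold Δ < lam`) there is a
degree `d`, `3 ≤ d ≤ Δ`, `λ > λ_c(𝕋_d)`, for which Sly's Condition 1.2 — hence his Theorem 2.1 — is in
print at `(d, λ)` (least such `d`: `d = 3`, all `λ > 4`: Galanis–Ge–Štefankovič–Vigoda–Yang Lemma 5;
`d = 4, 5`, all `λ > λ_c(𝕋_d)`: Galanis–Štefankovič–Vigoda 2016 Lemma 4 + §6 Lemma 19; `d ≥ 6`,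
`λ ∈ (λ_c(𝕋_d), λ_c(𝕋_{d-1})]`: GGŠVY Cor. 6 and §2.4 — the covering used in both papers' proofs of
their Theorem 1), and then: `θ ∈ (0, 1/8)` ("constants `0 < θ, ψ < 1/8` … chosen to depend on `λ`
and `d`") and reals `0 < q⁻ < q⁺ < 1` (the root occupation probabilities of the infinite `(d-1)`-ary
tree under the two extremal semi-translation-invariant measures; "as we have that
`0 < q⁻ < q⁺ < 1`") such that for every `ε > 0` and all sufficiently large `n` ("with probability
`1 - o(1)`" over `G(n, θ, ψ)`, hence for SOME graph) there is a gadget: a graph `G` on `v ≤ 3n`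
vertices ("`(2+o(1))n` vertices") of maximum degree `≤ d`, disjoint vertex sets `W⁺, W⁻` defining
the phase (`slyPhase`), and `m = slyM d θ n = (d-1)^{⌊θ log_{d-1} n⌋}` ports `V⁺ : Fin m ↪ V(G)` and
`m` ports `V⁻`, all distinct and of degree `≤ d - 1` ("the set of roots `V⁺` which are vertices of
degree `d - 1`"), with
* `(GpropA)`, `(GpropB)` of Theorem 2.1 with `δ = n^{-2θ}` (`SlyPropA`, `SlyPropB`), and
* for every `N ≤ n^{θ/4}/(d-1)` ("let `H` be a graph on up to `n^{θ/4}/(d-1)` vertices"), the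
  conclusions `(phaseProbs)`, `(cutProb)` of Lemma 2.2 for every graph `H` on `Fin N`, every port
  reservation `ι : Fin N × Fin κ ↪ Fin m`, `κ = slyK θ n = ⌊n^{3θ/4}⌋₊`, and every phase vector, with
  relative error `ε` (`SlyCutEstimate`).
Consequence used by route PneNP/PhaseTwins (proved below, `slyGadgetReduction.twins`): graphs
`H₀, H₁` on `Fin N` with `|E(H₀)| = |E(H₁)|` and `maxcut(H₁) < maxcut(H₀)` have
`Z(H₀^G) ≥ M · Z(H₁^G)` for `n` large. Not in Mathlib; stated as a `Prop` (the proof is a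
second-moment analysis of random bipartite regular graphs with small-subgraph conditioning and a
reconstruction argument on trees).
[cite: Sly2010, Thm 2.1 and Lemma 2.2 (§2); range of (d, λ): GalanisEtAl2012 Lemma 5, Cor. 6, §2.4 and GalanisStefankovicVigoda2016 Lemma 4, §6 Lemma 19] -/
def slyGadgetReduction : Prop :=
  ∀ Δ : ℕ, 3 ≤ Δ → ∀ lam : ℝ, hardCoreThreshold Δ < lam →
    ∃ d : ℕ, 3 ≤ d ∧ d ≤ Δ ∧ hardCoreThreshold d < lam ∧
    ∃ θ qp qm : ℝ, 0 < θ ∧ θ < 1 / 8 ∧ 0 < qm ∧ qm < qp ∧ qp < 1 ∧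
      ∀ ε : ℝ, 0 < ε → ∃ n₀ : ℕ, ∀ n : ℕ, n₀ ≤ n →
        ∃ (v : ℕ) (G : SimpleGraph (Fin v)) (Wp Wm : Finset (Fin v))
          (Vp Vm : Fin (slyM d θ n) ↪ Fin v),
          (v : ℝ) ≤ 3 * n ∧ G.maxDegree ≤ d ∧ Disjoint Wp Wm ∧
            Disjoint (Set.range Vp) (Set.range Vm) ∧
            (∀ i, G.degree (Vp i) ≤ d - 1) ∧ (∀ i, G.degree (Vm i) ≤ d - 1) ∧
            SlyPropA G lam Wp Wm n ∧
            SlyPropB G lam Wp Wm Vp Vm qp qm ((n : ℝ) ^ (-(2 * θ))) ∧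
            ∀ N : ℕ, (N : ℝ) ≤ (n : ℝ) ^ (θ / 4) / ((d : ℝ) - 1) →
              SlyCutEstimate G lam Wp Wm Vp Vm qp qm ε n θ N (slyK θ n)

/-! ### Consequences: summing over phases, and the twin estimate used by route PneNP/PhaseTwins -/

section Consequences

variable {V : Type*} [Fintype V] [DecidableEq V]

open scoped Classical in
/-- **Partition by an observable**: summing the restricted partition functions `Z_G(λ; f = b)` over all
values `b` of a finite-valued function `f` of the configuration gives `Z_G(λ)` (e.g. `Z_{H^G} =
Σ_{𝒴'} Z_{H^G}(𝒴')`, Sly 2010 §2.2). [folklore] -/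
theorem sum_hardcoreZOn_fiber (G : SimpleGraph V) (lam : ℝ) {β : Type*} [Fintype β]
    (f : Finset V → β) : ∑ b, hardcoreZOn G lam (fun I => f I = b) = independencePolynomial G lam := by
  simp only [hardcoreZOn_def, independencePolynomial]
  rw [Finset.sum_comm]
  refine Finset.sum_congr rfl fun I _ => ?_
  by_cases hI : G.IsIndepSet (↑I : Set V)
  · simp [hI, Finset.sum_ite_eq]
  · simp [hI]

/-- Two-sided reading of a relative-error estimate `|a - b| ≤ ε b`. [folklore] -/
theorem le_and_le_of_abs_sub_le {a b ε : ℝ} (h : |a - b| ≤ ε * b) :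
    (1 - ε) * b ≤ a ∧ a ≤ (1 + ε) * b := by
  rw [abs_sub_le_iff] at h
  constructor <;> nlinarith [h.1, h.2]

/-- **Growth comparison behind Sly's reduction**: for `B > 1` and `θ > 0`,
`3 M · n^{n^{θ/4}} ≤ B^{⌊n^{3θ/4}⌋₊}` for all large `n` (the cut gain `B^{κ}`, `κ = n^{3θ/4}`, beats the
phase entropy `n^{n^{θ/4}}` of `(phaseProbs)`; Sly: "`≥ [B]^{n^{3θ/4}/2} ≥ 4^{n^{θ/4}}` for large
enough `n`"). [cite: Sly2010, proof of Thm 1 (§2.2)] -/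
theorem eventually_mul_rpow_rpow_le_slyB_pow {B θ : ℝ} (hB : 1 < B) (hθ : 0 < θ) (M : ℝ) :
    ∃ n₀ : ℕ, ∀ n : ℕ, n₀ ≤ n → 3 * M * (n : ℝ) ^ ((n : ℝ) ^ (θ / 4)) ≤ B ^ slyK θ n := by
  by_cases hM : M ≤ 0
  · refine ⟨0, fun n _ => ?_⟩
    have h1 : 3 * M * (n : ℝ) ^ ((n : ℝ) ^ (θ / 4)) ≤ 0 :=
      mul_nonpos_of_nonpos_of_nonneg (by linarith) (Real.rpow_nonneg (Nat.cast_nonneg n) _)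
    exact h1.trans (pow_nonneg (by linarith) _)
  rw [not_le] at hM
  have hlogB : 0 < Real.log B := Real.log_pos hB
  -- (1) eventually `log n ≤ (log B / 2) · n^{θ/2}`
  have h1 : ∀ᶠ n : ℕ in Filter.atTop, Real.log n ≤ Real.log B / 2 * (n : ℝ) ^ (θ / 2) := by
    have hlo := (isLittleO_log_rpow_atTop (half_pos hθ)).bound (half_pos hlogB)
    filter_upwards [tendsto_natCast_atTop_atTop.eventually hlo] with n hn
    have ha : Real.log n ≤ ‖Real.log (n : ℝ)‖ := Real.le_norm_self _
    have hb : ‖(n : ℝ) ^ (θ / 2)‖ = (n : ℝ) ^ (θ / 2) :=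
      Real.norm_of_nonneg (Real.rpow_nonneg (Nat.cast_nonneg n) _)
    linarith [hb ▸ hn]
  -- (2) eventually `log B + log (3M) ≤ (log B / 2) · n^{3θ/4}`
  have h2 : ∀ᶠ n : ℕ in Filter.atTop,
      Real.log B + Real.log (3 * M) ≤ Real.log B / 2 * (n : ℝ) ^ (3 * θ / 4) := by
    have ht : Filter.Tendsto (fun n : ℕ => Real.log B / 2 * (n : ℝ) ^ (3 * θ / 4)) Filter.atTop
        Filter.atTop :=
      Filter.Tendsto.const_mul_atTop (half_pos hlogB)
        ((tendsto_rpow_atTop (by positivity)).comp tendsto_natCast_atTop_atTop)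
    exact ht.eventually_ge_atTop _
  -- (3) eventually `1 ≤ n`
  have h3 : ∀ᶠ n : ℕ in Filter.atTop, 1 ≤ n := Filter.eventually_ge_atTop 1
  obtain ⟨n₀, hn₀⟩ := Filter.eventually_atTop.1 (h1.and (h2.and h3))
  refine ⟨n₀, fun n hn => ?_⟩
  obtain ⟨hn1, hn2, hn3⟩ := hn₀ n hn
  have hnpos : (0 : ℝ) < n := by exact_mod_cast hn3
  have hB0 : 0 < B := by linarith
  -- the exponent `κ = ⌊n^{3θ/4}⌋₊ ≥ n^{3θ/4} - 1`
  have hκ : (n : ℝ) ^ (3 * θ / 4) - 1 ≤ (slyK θ n : ℝ) := by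
    unfold slyK
    have := Nat.lt_floor_add_one ((n : ℝ) ^ (3 * θ / 4))
    linarith
  -- `n^{θ/4} log n ≤ (log B / 2) n^{3θ/4}`
  have h4 : (n : ℝ) ^ (θ / 4) * Real.log n ≤ Real.log B / 2 * (n : ℝ) ^ (3 * θ / 4) := by
    have hq : 0 ≤ (n : ℝ) ^ (θ / 4) := Real.rpow_nonneg hnpos.le _
    calc (n : ℝ) ^ (θ / 4) * Real.log n
        ≤ (n : ℝ) ^ (θ / 4) * (Real.log B / 2 * (n : ℝ) ^ (θ / 2)) :=
          mul_le_mul_of_nonneg_left hn1 hq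
      _ = Real.log B / 2 * ((n : ℝ) ^ (θ / 4) * (n : ℝ) ^ (θ / 2)) := by ring
      _ = Real.log B / 2 * (n : ℝ) ^ (3 * θ / 4) := by
          rw [← Real.rpow_add hnpos]; ring_nf
  -- logarithmic form of the claim
  have hlog : Real.log (3 * M) + (n : ℝ) ^ (θ / 4) * Real.log n ≤ Real.log B * slyK θ n := by
    have h5 : Real.log B * ((n : ℝ) ^ (3 * θ / 4) - 1) ≤ Real.log B * slyK θ n :=
      mul_le_mul_of_nonneg_left hκ hlogB.le
    nlinarith [h5, h4, hn2]
  -- exponentiate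
  have hlhs : 3 * M * (n : ℝ) ^ ((n : ℝ) ^ (θ / 4)) =
      Real.exp (Real.log (3 * M) + (n : ℝ) ^ (θ / 4) * Real.log n) := by
    rw [Real.exp_add, Real.exp_log (by positivity), Real.rpow_def_of_pos hnpos, mul_comm (Real.log _)]
  have hrhs : B ^ slyK θ n = Real.exp (Real.log B * slyK θ n) := by
    rw [← Real.rpow_natCast, Real.rpow_def_of_pos hB0]
  rw [hlhs, hrhs, Real.exp_le_exp]
  exact hlog


end Consequences

open scoped Classical in
/-- **The twin estimate (what route PneNP/PhaseTwins consumes from Sly's reduction).** Assume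
`slyGadgetReduction`. For `Δ ≥ 3` and `λ > λ_c(𝕋_Δ)` there are `d ∈ [3, Δ]` and `θ ∈ (0, 1/8)` such
that for every real `M` and all large `n` there is a gadget `G` on `v ≤ 3n` vertices, of maximum
degree `≤ d ≤ Δ`, with `2m` distinct ports `V⁺, V⁻ : Fin m ↪ Fin v` (`m = slyM d θ n`) of degree
`≤ d - 1`, such that for every `N ≤ n^{θ/4}/(d-1)`, every port reservation `ι` (`κ = slyK θ n` new
edges per edge and side) and all graphs `H₀, H₁` on `Fin N` with the same number of edges and
`maxcut(H₁) < maxcut(H₀)`: `M · Z_{H₁^G}(λ) ≤ Z_{H₀^G}(λ)` (`Z = independencePolynomial`, classical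
decidability; `H_i^G = gadgetSubst H_i G V⁺ V⁻ ι` has maximum degree `≤ d` by
`maxDegree_gadgetSubst_le`). Proof (Sly 2010 §2.2, proof of Thm 1, run for two graphs sharing
`Ĥ^G` and `C_{H₀} = C_{H₁}`): summing `(cutProb)` over phase vectors,
`Z_{H₁^G} ≤ (1+ε) C B^{κ·maxcut(H₁)} Z_{Ĥ^G}`, while at a maximum cut `𝒴₀` of `H₀`, by `(cutProb)`
and `(phaseProbs)`, `Z_{H₀^G} ≥ (1-ε) C B^{κ·maxcut(H₀)} n^{-n^{θ/4}} Z_{Ĥ^G}`; and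
`B^{κ} ≥ 3M n^{n^{θ/4}}` for large `n` (`eventually_mul_rpow_rpow_le_slyB_pow`, `B > 1`).
[cite: Sly2010, §2.2 (Lemma 2.2 and proof of Thm 1)] -/
theorem slyGadgetReduction.twins (h : slyGadgetReduction) {Δ : ℕ} (hΔ : 3 ≤ Δ) {lam : ℝ}
    (hlam : hardCoreThreshold Δ < lam) :
    ∃ d : ℕ, 3 ≤ d ∧ d ≤ Δ ∧ ∃ θ : ℝ, 0 < θ ∧ θ < 1 / 8 ∧ ∀ M : ℝ, ∃ n₀ : ℕ, ∀ n : ℕ, n₀ ≤ n →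
      ∃ (v : ℕ) (G : SimpleGraph (Fin v)) (Vp Vm : Fin (slyM d θ n) ↪ Fin v),
        (v : ℝ) ≤ 3 * n ∧ G.maxDegree ≤ d ∧ Disjoint (Set.range Vp) (Set.range Vm) ∧
          (∀ i, G.degree (Vp i) ≤ d - 1) ∧ (∀ i, G.degree (Vm i) ≤ d - 1) ∧
          ∀ N : ℕ, (N : ℝ) ≤ (n : ℝ) ^ (θ / 4) / ((d : ℝ) - 1) →
            ∀ (ι : Fin N × Fin (slyK θ n) ↪ Fin (slyM d θ n)) (H₀ H₁ : SimpleGraph (Fin N)),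
              H₀.edgeFinset.card = H₁.edgeFinset.card → maxCut H₁ < maxCut H₀ →
                M * independencePolynomial (gadgetSubst H₁ G Vp Vm ι) lam ≤
                  independencePolynomial (gadgetSubst H₀ G Vp Vm ι) lam := by
  obtain ⟨d, hd3, hdΔ, hdlam, θ, qp, qm, hθ, hθ8, hqm, hqlt, hqp, hmain⟩ := h Δ hΔ lam hlam
  refine ⟨d, hd3, hdΔ, θ, hθ, hθ8, fun M => ?_⟩
  obtain ⟨n₁, hn₁⟩ := hmain (1 / 2) (by norm_num)
  have hB : 1 < slyB qp qm := one_lt_slyB hqm hqlt hqp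
  have hB1 : 1 ≤ slyB qp qm := hB.le
  obtain ⟨n₂, hn₂⟩ := eventually_mul_rpow_rpow_le_slyB_pow hB hθ M
  refine ⟨max n₁ n₂ + 1, fun n hn => ?_⟩
  have hn1 : n₁ ≤ n := by omega
  have hn2 : n₂ ≤ n := by omega
  have hnpos : (0 : ℝ) < n := by exact_mod_cast (show 0 < n by omega)
  obtain ⟨v, G, Wp, Wm, Vp, Vm, hv, hdeg, -, hVV, hdp, hdm, -, -, hcut⟩ := hn₁ n hn1
  refine ⟨v, G, Vp, Vm, hv, hdeg, hVV, hdp, hdm, fun N hN ι H₀ H₁ hE hmc => ?_⟩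
  have hlam0 : 0 ≤ lam := ((hardCoreThreshold_pos hd3).trans hdlam).le
  have est := hcut N hN
  have hCpos : 0 < slyC qp qm (slyK θ n) H₀.edgeFinset.card := slyC_pos hqm hqlt hqp _ _
  have hZb0 : 0 ≤ independencePolynomial (gadgetSubst ⊥ G Vp Vm ι) lam := (independencePolynomial_pos _ hlam0).le
  have hP0 : 0 ≤ (n : ℝ) ^ (-((n : ℝ) ^ (θ / 4))) := Real.rpow_nonneg hnpos.le _
  -- Step A: `Z_{H₁^G} ≤ (3/2) C B^{κ maxcut H₁} Z_{Ĥ^G}` (sum `(cutProb)` over phase vectors)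
  have hup : independencePolynomial (gadgetSubst H₁ G Vp Vm ι) lam ≤
      3 / 2 * slyC qp qm (slyK θ n) H₀.edgeFinset.card * slyB qp qm ^ (slyK θ n * maxCut H₁) *
        independencePolynomial (gadgetSubst ⊥ G Vp Vm ι) lam := by
    rw [← sum_hardcoreZOn_fiber (gadgetSubst H₁ G Vp Vm ι) lam (phaseVec Wp Wm),
      ← sum_hardcoreZOn_fiber (gadgetSubst ⊥ G Vp Vm ι) lam (phaseVec Wp Wm), Finset.mul_sum]
    refine Finset.sum_le_sum fun Y _ => ?_
    have hY := (est ι H₁ Y).2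
    rw [← hE] at hY
    have h2 := (le_and_le_of_abs_sub_le hY).2
    have hZ0 : 0 ≤ hardcoreZOn (gadgetSubst ⊥ G Vp Vm ι) lam (fun I => phaseVec Wp Wm I = Y) :=
      hardcoreZOn_nonneg _ hlam0 _
    have hpow : slyB qp qm ^ (slyK θ n * cutSize H₁ Y) ≤ slyB qp qm ^ (slyK θ n * maxCut H₁) :=
      pow_le_pow_right₀ hB1 (Nat.mul_le_mul_left _ (cutSize_le_maxCut H₁ Y))
    have h3 : slyC qp qm (slyK θ n) H₀.edgeFinset.card * slyB qp qm ^ (slyK θ n * cutSize H₁ Y) *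
          hardcoreZOn (gadgetSubst ⊥ G Vp Vm ι) lam (fun I => phaseVec Wp Wm I = Y) ≤
        slyC qp qm (slyK θ n) H₀.edgeFinset.card * slyB qp qm ^ (slyK θ n * maxCut H₁) *
          hardcoreZOn (gadgetSubst ⊥ G Vp Vm ι) lam (fun I => phaseVec Wp Wm I = Y) := by
      gcongr
    linarith
  -- Step B: `Z_{H₀^G} ≥ (1/2) C B^{κ maxcut H₀} n^{-n^{θ/4}} Z_{Ĥ^G}` (at a maximum cut of `H₀`)
  obtain ⟨Y₀, hY₀⟩ := exists_cutSize_eq_maxCut H₀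
  have hlow : 1 / 2 * slyC qp qm (slyK θ n) H₀.edgeFinset.card * slyB qp qm ^ (slyK θ n * maxCut H₀) *
        ((n : ℝ) ^ (-((n : ℝ) ^ (θ / 4))) * independencePolynomial (gadgetSubst ⊥ G Vp Vm ι) lam) ≤
      independencePolynomial (gadgetSubst H₀ G Vp Vm ι) lam := by
    have hY := est ι H₀ Y₀
    have h1 := (le_and_le_of_abs_sub_le hY.2).1
    rw [hY₀] at h1
    calc 1 / 2 * slyC qp qm (slyK θ n) H₀.edgeFinset.card * slyB qp qm ^ (slyK θ n * maxCut H₀) *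
          ((n : ℝ) ^ (-((n : ℝ) ^ (θ / 4))) * independencePolynomial (gadgetSubst ⊥ G Vp Vm ι) lam)
        ≤ 1 / 2 * slyC qp qm (slyK θ n) H₀.edgeFinset.card * slyB qp qm ^ (slyK θ n * maxCut H₀) *
          hardcoreZOn (gadgetSubst ⊥ G Vp Vm ι) lam (fun I => phaseVec Wp Wm I = Y₀) := by
          gcongr
          exact hY.1
      _ = (1 - 1 / 2) * (slyC qp qm (slyK θ n) H₀.edgeFinset.card *
            slyB qp qm ^ (slyK θ n * maxCut H₀) *
            hardcoreZOn (gadgetSubst ⊥ G Vp Vm ι) lam (fun I => phaseVec Wp Wm I = Y₀)) := by ring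
      _ ≤ hardcoreZOn (gadgetSubst H₀ G Vp Vm ι) lam (fun I => phaseVec Wp Wm I = Y₀) := h1
      _ ≤ independencePolynomial (gadgetSubst H₀ G Vp Vm ι) lam := hardcoreZOn_le_independencePolynomial _ hlam0 _
  -- Step C: compare, using `3 M n^{n^{θ/4}} ≤ B^κ` and `B^κ · B^{κ maxcut H₁} ≤ B^{κ maxcut H₀}`
  by_cases hM : M ≤ 0
  · exact (mul_nonpos_of_nonpos_of_nonneg hM ((independencePolynomial_pos _ hlam0).le)).trans
      ((independencePolynomial_pos _ hlam0).le)
  rw [not_le] at hM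
  have hPinv : (n : ℝ) ^ ((n : ℝ) ^ (θ / 4)) * (n : ℝ) ^ (-((n : ℝ) ^ (θ / 4))) = 1 := by
    rw [Real.rpow_neg hnpos.le, mul_inv_cancel₀ (Real.rpow_pos_of_pos hnpos _).ne']
  have h3M : 3 * M ≤ slyB qp qm ^ slyK θ n * (n : ℝ) ^ (-((n : ℝ) ^ (θ / 4))) := by
    have hg := mul_le_mul_of_nonneg_right (hn₂ n hn2) hP0
    calc 3 * M = 3 * M * ((n : ℝ) ^ ((n : ℝ) ^ (θ / 4)) * (n : ℝ) ^ (-((n : ℝ) ^ (θ / 4)))) := by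
          rw [hPinv, mul_one]
      _ = 3 * M * (n : ℝ) ^ ((n : ℝ) ^ (θ / 4)) * (n : ℝ) ^ (-((n : ℝ) ^ (θ / 4))) := by ring
      _ ≤ slyB qp qm ^ slyK θ n * (n : ℝ) ^ (-((n : ℝ) ^ (θ / 4))) := hg
  have hpow : slyB qp qm ^ slyK θ n * slyB qp qm ^ (slyK θ n * maxCut H₁) ≤
      slyB qp qm ^ (slyK θ n * maxCut H₀) := by
    rw [← pow_add]
    refine pow_le_pow_right₀ hB1 ?_
    calc slyK θ n + slyK θ n * maxCut H₁ = slyK θ n * (maxCut H₁ + 1) := by ring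
      _ ≤ slyK θ n * maxCut H₀ := Nat.mul_le_mul_left _ hmc
  calc M * independencePolynomial (gadgetSubst H₁ G Vp Vm ι) lam
      ≤ M * (3 / 2 * slyC qp qm (slyK θ n) H₀.edgeFinset.card * slyB qp qm ^ (slyK θ n * maxCut H₁) *
          independencePolynomial (gadgetSubst ⊥ G Vp Vm ι) lam) := mul_le_mul_of_nonneg_left hup hM.le
    _ = 1 / 2 * (3 * M) * (slyC qp qm (slyK θ n) H₀.edgeFinset.card *
          slyB qp qm ^ (slyK θ n * maxCut H₁) * independencePolynomial (gadgetSubst ⊥ G Vp Vm ι) lam) := by ring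
    _ ≤ 1 / 2 * (slyB qp qm ^ slyK θ n * (n : ℝ) ^ (-((n : ℝ) ^ (θ / 4)))) *
          (slyC qp qm (slyK θ n) H₀.edgeFinset.card *
          slyB qp qm ^ (slyK θ n * maxCut H₁) * independencePolynomial (gadgetSubst ⊥ G Vp Vm ι) lam) := by
        gcongr
    _ = 1 / 2 * slyC qp qm (slyK θ n) H₀.edgeFinset.card *
          (slyB qp qm ^ slyK θ n * slyB qp qm ^ (slyK θ n * maxCut H₁)) *
          ((n : ℝ) ^ (-((n : ℝ) ^ (θ / 4))) * independencePolynomial (gadgetSubst ⊥ G Vp Vm ι) lam) := by ring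
    _ ≤ 1 / 2 * slyC qp qm (slyK θ n) H₀.edgeFinset.card * slyB qp qm ^ (slyK θ n * maxCut H₀) *
          ((n : ℝ) ^ (-((n : ℝ) ^ (θ / 4))) * independencePolynomial (gadgetSubst ⊥ G Vp Vm ι) lam) := by
        gcongr
    _ ≤ independencePolynomial (gadgetSubst H₀ G Vp Vm ι) lam := hlow


/-! ### The substituted graph keeps maximum degree `Δ`, and port reservations exist -/

section Degree

variable {V : Type*} [Fintype V] [DecidableEq V]

open scoped Classical in
/-- **`H^G` has maximum degree `≤ Δ`** ("this can be done deterministically in such a way that no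
vertex in `Ĥ^G` has its degree increased by more than 1 … the resulting graph has maximum degree
`d`"): if every vertex of `G` has degree `≤ Δ`, the ports are pairwise distinct (`V⁺, V⁻` embeddings
with disjoint ranges) and have degree `≤ Δ - 1`, then every vertex of `gadgetSubst H G V⁺ V⁻ ι` has
degree `≤ Δ`: a non-port keeps its `G`-neighbours, a port `V^{±}(ι(y, j))` of copy `x` gains the single
new neighbour `(y, V^{±}(ι(x, j)))`, and only when `xy ∈ E(H)`. [cite: Sly2010, §2.2 (construction of `H^G`)] -/
theorem degree_gadgetSubst_le {N κ m Δ : ℕ} (H : SimpleGraph (Fin N)) (G : SimpleGraph V)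
    (Vp Vm : Fin m ↪ V) (ι : Fin N × Fin κ ↪ Fin m) (hΔ : 1 ≤ Δ) (hG : ∀ a, G.degree a ≤ Δ)
    (hVV : Disjoint (Set.range Vp) (Set.range Vm)) (hp : ∀ i, G.degree (Vp i) ≤ Δ - 1)
    (hm : ∀ i, G.degree (Vm i) ≤ Δ - 1) (xa : Fin N × V) :
    (gadgetSubst H G Vp Vm ι).degree xa ≤ Δ := by
  obtain ⟨x, a⟩ := xa
  -- the two kinds of neighbours
  set A : Finset (Fin N × V) := (G.neighborFinset a).map ⟨fun b => (x, b), fun b b' h => by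
    simpa using h⟩ with hA
  set T : Finset (Fin N × V) := Finset.univ.filter fun yb : Fin N × V =>
    H.Adj x yb.1 ∧ ∃ j : Fin κ, (a = Vp (ι (yb.1, j)) ∧ yb.2 = Vp (ι (x, j))) ∨
      (a = Vm (ι (yb.1, j)) ∧ yb.2 = Vm (ι (x, j))) with hT
  have hsub : (gadgetSubst H G Vp Vm ι).neighborFinset (x, a) ⊆ A ∪ T := by
    intro yb hyb
    rw [SimpleGraph.mem_neighborFinset, gadgetSubst_adj] at hyb
    rcases hyb with ⟨h1, h2⟩ | h
    · refine Finset.mem_union.2 (Or.inl ?_)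
      rw [hA, Finset.mem_map]
      exact ⟨yb.2, (SimpleGraph.mem_neighborFinset _ _ _).2 h2, Prod.ext h1 rfl⟩
    · exact Finset.mem_union.2 (Or.inr (Finset.mem_filter.2 ⟨Finset.mem_univ _, h⟩))
  have hAcard : A.card = G.degree a := by
    rw [hA, Finset.card_map, SimpleGraph.card_neighborFinset_eq_degree]
  -- no vertex is both a `+`-port and a `−`-port
  have hpm : ∀ i i', Vp i ≠ Vm i' := fun i i' h =>
    Set.disjoint_left.1 hVV (Set.mem_range_self i) (h ▸ Set.mem_range_self i')
  -- at most one new neighbour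
  have hTcard : T.card ≤ 1 := by
    refine Finset.card_le_one.2 fun yb hyb yb' hyb' => ?_
    rw [hT, Finset.mem_filter] at hyb hyb'
    obtain ⟨-, j, hj⟩ := hyb.2
    obtain ⟨-, j', hj'⟩ := hyb'.2
    rcases hj with ⟨ha, hb⟩ | ⟨ha, hb⟩ <;> rcases hj' with ⟨ha', hb'⟩ | ⟨ha', hb'⟩
    · have hk := ι.injective (Vp.injective (ha.symm.trans ha'))
      simp only [Prod.mk.injEq] at hk
      exact Prod.ext hk.1 (by rw [hb, hb', hk.2])
    · exact absurd (ha.symm.trans ha') (hpm _ _)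
    · exact absurd (ha'.symm.trans ha) (hpm _ _)
    · have hk := ι.injective (Vm.injective (ha.symm.trans ha'))
      simp only [Prod.mk.injEq] at hk
      exact Prod.ext hk.1 (by rw [hb, hb', hk.2])
  have hdeg : (gadgetSubst H G Vp Vm ι).degree (x, a) ≤ G.degree a + T.card := by
    rw [← SimpleGraph.card_neighborFinset_eq_degree, ← hAcard]
    exact (Finset.card_le_card hsub).trans (Finset.card_union_le _ _)
  by_cases hport : (∃ i, a = Vp i) ∨ ∃ i, a = Vm i
  · -- a port: `G`-degree `≤ Δ - 1`, plus at most one new edge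
    have ha : G.degree a ≤ Δ - 1 := by
      rcases hport with ⟨i, rfl⟩ | ⟨i, rfl⟩
      · exact hp i
      · exact hm i
    omega
  · -- not a port: no new neighbour
    have hT0 : T.card = 0 := by
      rw [Finset.card_eq_zero, hT, Finset.filter_eq_empty_iff]
      rintro yb - ⟨-, j, ⟨ha, -⟩ | ⟨ha, -⟩⟩
      · exact hport (Or.inl ⟨_, ha⟩)
      · exact hport (Or.inr ⟨_, ha⟩)
    have := hG a
    omega

open scoped Classical in
/-- **`H^G` has maximum degree `≤ Δ`** when `G` does and the ports are distinct of degree `≤ Δ - 1`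
(the hypotheses provided by `slyGadgetReduction`). [cite: Sly2010, §2.2 ("the resulting graph has maximum degree `d`")] -/
theorem maxDegree_gadgetSubst_le {N κ m Δ : ℕ} (H : SimpleGraph (Fin N)) (G : SimpleGraph V)
    (Vp Vm : Fin m ↪ V) (ι : Fin N × Fin κ ↪ Fin m) (hΔ : 1 ≤ Δ) (hG : G.maxDegree ≤ Δ)
    (hVV : Disjoint (Set.range Vp) (Set.range Vm)) (hp : ∀ i, G.degree (Vp i) ≤ Δ - 1)
    (hm : ∀ i, G.degree (Vm i) ≤ Δ - 1) :
    (gadgetSubst H G Vp Vm ι).maxDegree ≤ Δ :=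
  SimpleGraph.maxDegree_le_of_forall_degree_le _ _ fun xa =>
    degree_gadgetSubst_le H G Vp Vm ι hΔ (fun a => (G.degree_le_maxDegree a).trans hG) hVV hp hm xa


/-- **Port reservations exist**: for `N ≤ n^{θ/4}/(Δ-1)` the `N · κ`, `κ = ⌊n^{3θ/4}⌋₊`, ports needed
on each side of each copy fit into the `m = (Δ-1)^{⌊θ log_{Δ-1} n⌋}` available ones, since
`N κ ≤ n^{θ}/(Δ-1) = (Δ-1)^{θ log_{Δ-1} n - 1} ≤ m` (Sly's reason for the bound on `|H|`).
[cite: Sly2010, §2.2 (the bound `|H| ≤ n^{θ/4}/(d-1)`)] -/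
theorem mul_slyK_le_slyM {Δ : ℕ} (hΔ : 3 ≤ Δ) {θ : ℝ} (hθ : 0 < θ) (n N : ℕ)
    (hN : (N : ℝ) ≤ (n : ℝ) ^ (θ / 4) / ((Δ : ℝ) - 1)) : N * slyK θ n ≤ slyM Δ θ n := by
  have h3 : (3 : ℝ) ≤ Δ := by exact_mod_cast hΔ
  have hb1 : (1 : ℝ) < (Δ : ℝ) - 1 := by linarith
  have hb0 : (0 : ℝ) < (Δ : ℝ) - 1 := by linarith
  rcases Nat.eq_zero_or_pos n with rfl | hn
  · have h0 : (N : ℝ) ≤ 0 := by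
      simpa [Real.zero_rpow (by positivity : θ / 4 ≠ 0)] using hN
    have hN0 : N = 0 := by exact_mod_cast le_antisymm h0 (Nat.cast_nonneg N)
    simp [hN0]
  have hnpos : (0 : ℝ) < n := by exact_mod_cast hn
  have hκ : (slyK θ n : ℝ) ≤ (n : ℝ) ^ (3 * θ / 4) := Nat.floor_le (Real.rpow_nonneg hnpos.le _)
  -- `N κ ≤ n^θ/(Δ-1)`
  have h1 : (N : ℝ) * slyK θ n ≤ (n : ℝ) ^ θ / ((Δ : ℝ) - 1) := by
    calc (N : ℝ) * slyK θ n ≤ (n : ℝ) ^ (θ / 4) / ((Δ : ℝ) - 1) * (n : ℝ) ^ (3 * θ / 4) :=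
          mul_le_mul hN hκ (Nat.cast_nonneg _) (by positivity)
      _ = (n : ℝ) ^ (θ / 4) * (n : ℝ) ^ (3 * θ / 4) / ((Δ : ℝ) - 1) := by ring
      _ = (n : ℝ) ^ θ / ((Δ : ℝ) - 1) := by rw [← Real.rpow_add hnpos]; ring_nf
  -- `n^θ/(Δ-1) = (Δ-1)^{θ log_{Δ-1} n - 1}`
  have h2 : (n : ℝ) ^ θ / ((Δ : ℝ) - 1) = ((Δ : ℝ) - 1) ^ (θ * Real.logb ((Δ : ℝ) - 1) n - 1) := by
    rw [Real.rpow_sub hb0, Real.rpow_one, mul_comm θ, Real.rpow_mul hb0.le,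
      Real.rpow_logb hb0 hb1.ne' hnpos]
  -- `θ log_{Δ-1} n - 1 ≤ ⌊θ log_{Δ-1} n⌋₊`
  have h3 : ((Δ : ℝ) - 1) ^ (θ * Real.logb ((Δ : ℝ) - 1) n - 1) ≤
      ((Δ : ℝ) - 1) ^ ((⌊θ * Real.logb ((Δ : ℝ) - 1) n⌋₊ : ℕ) : ℝ) :=
    Real.rpow_le_rpow_of_exponent_le hb1.le
      (by have := Nat.lt_floor_add_one (θ * Real.logb ((Δ : ℝ) - 1) n); linarith)
  have h4 : ((N * slyK θ n : ℕ) : ℝ) ≤ ((slyM Δ θ n : ℕ) : ℝ) := by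
    rw [Nat.cast_mul, slyM, Nat.cast_pow, Nat.cast_sub (by omega : 1 ≤ Δ), Nat.cast_one,
      ← Real.rpow_natCast]
    exact h1.trans (h2.le.trans h3)
  exact_mod_cast h4

/-- An explicit port reservation `Fin N × Fin κ ↪ Fin m` (row-major, `finProdFinEquiv`) whenever
`N κ ≤ m`. [folklore] -/
def portReservation {N κ m : ℕ} (h : N * κ ≤ m) : Fin N × Fin κ ↪ Fin m :=
  finProdFinEquiv.toEmbedding.trans (Fin.castLEEmb h)

end Degree


/-! ### Sly's Lemma 2.2, proved: from `(GpropA)`, `(GpropB)` to `(phaseProbs)`, `(cutProb)`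

The deterministic half of the reduction (Sly 2010, Lemma 2.2; GŠV16 §6.3) as theorems: the
configurations of `H^G` decompose into families of configurations of the copies
(`isIndepSet_gadgetSubst_iff`, `sum_eq_sum_copyFiber`); on `Ĥ^G` the phase-restricted partition
function is the product of those of the copies (`hardcoreZOn_gadgetSubst_bot_phaseVec`,
`independencePolynomial_gadgetSubst_bot`), whence `(phaseProbs)` (`phaseProbs_of_slyPropA`);
`Z_{H^G}(𝒴')` is a sum over admissible families of port configurations
(`hardcoreZOn_gadgetSubst_phaseVec_eq_sum`), `(GpropB)` compares each family with the product
measures `Q^{𝒴'_x}` (`cutProb_bounds_of_slyPropB`), and under the product measures the probability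
that no new edge is doubly occupied is exactly `C_H B^{κ Cut(𝒴')}` (`sum_patterns_portLaw`, via the
Bernoulli computations `SlyReduction.sum_bernoulliWeight_superset`,
`SlyReduction.sum_bernoulliWeight_noPair`); the errors `(1 ± n^{-2θ})^N`, `N ≤ n^{θ/4}`, are
`1 + o(1)` (`SlyReduction.eventually_pow_error_le`). Assembled: `slyCutEstimate_of_slyProps` — for
`n ≥ n₀(θ, ε)` every gadget with `SlyPropA`, `SlyPropB (δ = n^{-2θ})` satisfies
`SlyCutEstimate … ε n θ N κ` for all `N ≤ n^{θ/4}` and all `κ` —, and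
`slyGadgetReduction_of_gadgets`: the fact `slyGadgetReduction` follows from the derandomised
content of Sly's Theorem 2.1 alone. Generic helpers live in the sub-namespace `SlyReduction`. -/

section CopyDecomposition

variable {V : Type*} [Fintype V] [DecidableEq V]

namespace SlyReduction

omit [Fintype V] [DecidableEq V] in
/-- A finite vertex set is independent iff no two of its members are adjacent. [folklore] -/
theorem isIndepSet_coe_finset_iff (G : SimpleGraph V) (I : Finset V) :
    G.IsIndepSet (↑I : Set V) ↔ ∀ a ∈ I, ∀ b ∈ I, ¬ G.Adj a b := by
  constructor
  · intro h a ha b hb hab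
    exact h (Finset.mem_coe.2 ha) (Finset.mem_coe.2 hb) (G.ne_of_adj hab) hab
  · intro h a ha b hb _
    exact h a (Finset.mem_coe.1 ha) b (Finset.mem_coe.1 hb)

end SlyReduction

/-- Reindexing configurations of `Fin N × V` by their families of fibres
`x ↦ copyFiber I x` (a bijection onto `Fin N → Finset V`). [folklore] -/
theorem sum_eq_sum_copyFiber {N : ℕ} {M : Type*} [AddCommMonoid M] (f : (Fin N → Finset V) → M) :
    ∑ I : Finset (Fin N × V), f (fun x => copyFiber I x) = ∑ F : Fin N → Finset V, f F := by
  refine Fintype.sum_equiv ⟨fun I x => copyFiber I x,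
    fun F => Finset.univ.filter fun a : Fin N × V => a.2 ∈ F a.1, ?_, ?_⟩ _ _ fun I => rfl
  · intro I
    ext ⟨x, a⟩
    simp [mem_copyFiber]
  · intro F
    funext x
    ext a
    simp [mem_copyFiber]

omit [Fintype V] in
/-- The size of a configuration of `Fin N × V` is the sum of the sizes of its fibres. [folklore] -/
theorem card_eq_sum_card_copyFiber {N : ℕ} (I : Finset (Fin N × V)) :
    I.card = ∑ x, (copyFiber I x).card := by
  rw [Finset.card_eq_sum_card_fiberwise (f := Prod.fst) (t := Finset.univ) fun _ _ => Finset.mem_univ _]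
  refine Finset.sum_congr rfl fun x _ => ?_
  rw [copyFiber, Finset.card_image_of_injOn]
  rintro ⟨x₁, a₁⟩ h₁ ⟨x₂, a₂⟩ h₂ (h : a₁ = a₂)
  simp only [Finset.coe_filter, Set.mem_setOf_eq] at h₁ h₂
  exact Prod.ext (h₁.2.trans h₂.2.symm) h

omit [Fintype V] in
/-- **Independent sets of `H^G`**: a configuration of `gadgetSubst H G V⁺ V⁻ ι` is independent iff
each fibre is independent in `G` and no new edge — `(x, V^{±}(ι(y,j))) ∼ (y, V^{±}(ι(x,j)))` for
`xy ∈ E(H)` — has both endpoints occupied. [cite: Sly2010, §2.2 (construction of `H^G`)] -/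
theorem isIndepSet_gadgetSubst_iff {N κ m : ℕ} (H : SimpleGraph (Fin N)) (G : SimpleGraph V)
    (Vp Vm : Fin m ↪ V) (ι : Fin N × Fin κ ↪ Fin m) (I : Finset (Fin N × V)) :
    (gadgetSubst H G Vp Vm ι).IsIndepSet (↑I : Set (Fin N × V)) ↔
      (∀ x, G.IsIndepSet (↑(copyFiber I x) : Set V)) ∧
        ∀ x y, H.Adj x y → ∀ j : Fin κ,
          ¬ ((x, Vp (ι (y, j))) ∈ I ∧ (y, Vp (ι (x, j))) ∈ I) ∧
            ¬ ((x, Vm (ι (y, j))) ∈ I ∧ (y, Vm (ι (x, j))) ∈ I) := by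
  simp only [SlyReduction.isIndepSet_coe_finset_iff, mem_copyFiber, gadgetSubst_adj]
  constructor
  · intro h
    refine ⟨fun x a ha b hb hab => h (x, a) ha (x, b) hb (Or.inl ⟨rfl, hab⟩),
      fun x y hxy j => ⟨?_, ?_⟩⟩
    · rintro ⟨ha, hb⟩
      exact h _ ha _ hb (Or.inr ⟨hxy, j, Or.inl ⟨rfl, rfl⟩⟩)
    · rintro ⟨ha, hb⟩
      exact h _ ha _ hb (Or.inr ⟨hxy, j, Or.inr ⟨rfl, rfl⟩⟩)
  · rintro ⟨h1, h2⟩ ⟨x, a⟩ ha ⟨y, b⟩ hb hab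
    rcases hab with ⟨hxy, hG⟩ | ⟨hxy, j, hj⟩
    · dsimp only at hxy hG
      subst hxy
      exact h1 x a ha b hb hG
    · dsimp only at hxy hj
      rcases hj with ⟨rfl, rfl⟩ | ⟨rfl, rfl⟩
      · exact (h2 x y hxy j).1 ⟨ha, hb⟩
      · exact (h2 x y hxy j).2 ⟨ha, hb⟩

omit [Fintype V] in
/-- **Independent sets of `Ĥ^G`** (disjoint copies): a configuration is independent iff each fibre
is. [cite: Sly2010, §2.2 (the graph `Ĥ^G`)] -/
theorem isIndepSet_gadgetSubst_bot_iff {N κ m : ℕ} (G : SimpleGraph V) (Vp Vm : Fin m ↪ V)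
    (ι : Fin N × Fin κ ↪ Fin m) (I : Finset (Fin N × V)) :
    (gadgetSubst ⊥ G Vp Vm ι).IsIndepSet (↑I : Set (Fin N × V)) ↔
      ∀ x, G.IsIndepSet (↑(copyFiber I x) : Set V) := by
  rw [isIndepSet_gadgetSubst_iff]
  simp

/-- **`Z_{Ĥ^G}(λ; 𝒴 = 𝒴') = Π_x Z_G(λ; Y = 𝒴'_x)`**: on the disjoint union of the copies the
phase-restricted partition function factorises ("the distribution of a configuration on `Ĥ^G` is
given by the product measure of configurations on the `(G_x)_{x ∈ H}`. In particular the phases are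
independent"). [cite: Sly2010, Lemma 2.2 (proof, first display)] -/
theorem hardcoreZOn_gadgetSubst_bot_phaseVec {N κ m : ℕ} (G : SimpleGraph V) (Vp Vm : Fin m ↪ V)
    (ι : Fin N × Fin κ ↪ Fin m) (lam : ℝ) (Wp Wm : Finset V) (Y : Fin N → Bool) :
    hardcoreZOn (gadgetSubst ⊥ G Vp Vm ι) lam (fun I => phaseVec Wp Wm I = Y) =
      ∏ x, hardcoreZOn G lam (fun S => slyPhase Wp Wm S = Y x) := by
  simp only [hardcoreZOn_def]
  rw [Fintype.prod_sum, ← sum_eq_sum_copyFiber]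
  refine Finset.sum_congr rfl fun I _ => ?_
  have hiff : (gadgetSubst ⊥ G Vp Vm ι).IsIndepSet (↑I : Set (Fin N × V)) ∧ phaseVec Wp Wm I = Y ↔
      ∀ x, G.IsIndepSet (↑(copyFiber I x) : Set V) ∧ slyPhase Wp Wm (copyFiber I x) = Y x := by
    rw [isIndepSet_gadgetSubst_bot_iff, funext_iff, ← forall_and]
    rfl
  by_cases h : (gadgetSubst ⊥ G Vp Vm ι).IsIndepSet (↑I : Set (Fin N × V)) ∧ phaseVec Wp Wm I = Y
  · rw [if_pos h, Finset.prod_congr rfl fun x _ => if_pos (hiff.1 h x), Finset.prod_pow_eq_pow_sum,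
      card_eq_sum_card_copyFiber]
  · rw [if_neg h]
    obtain ⟨x, hx⟩ := not_forall.1 fun h' => h (hiff.2 h')
    exact (Finset.prod_eq_zero (Finset.mem_univ x) (if_neg hx)).symm

open scoped Classical in
/-- **`Z_{Ĥ^G}(λ) = Z_G(λ)^{|H|}`**: the partition function of `|H|` disjoint copies of `G`
(classical decidability of adjacency, as everywhere in this file). [cite: Sly2010, Lemma 2.2 (proof)] -/
theorem independencePolynomial_gadgetSubst_bot {N κ m : ℕ} (G : SimpleGraph V) (Vp Vm : Fin m ↪ V)
    (ι : Fin N × Fin κ ↪ Fin m) (lam : ℝ) :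
    independencePolynomial (gadgetSubst ⊥ G Vp Vm ι) lam = independencePolynomial G lam ^ N := by
  have h := hardcoreZOn_gadgetSubst_bot_phaseVec G Vp Vm ι lam ∅ ∅ (fun _ => true)
  have hphase : ∀ S : Finset V, slyPhase ∅ ∅ S = true := fun S => by simp [slyPhase]
  have hvec : ∀ I : Finset (Fin N × V), phaseVec (∅ : Finset V) ∅ I = fun _ => true :=
    fun I => funext fun x => hphase _
  simp only [hvec, hphase] at h
  rw [hardcoreZOn_true, Finset.prod_const, Finset.card_univ, Fintype.card_fin] at h
  simp only [hardcoreZOn_true] at h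
  convert h using 2

end CopyDecomposition


section Bernoulli

namespace SlyReduction

variable {C : Type*} [Fintype C] [DecidableEq C]

/-- **Marginals of a Bernoulli product measure**: with independent coordinates `c` occupied with
probability `p c`, the probability that all coordinates of `D` are occupied is `Π_{c ∈ D} p c`.
[folklore] -/
theorem sum_bernoulliWeight_superset (p : C → ℝ) (D : Finset C) :
    ∑ t : Finset C, ((∏ c ∈ t, p c) * ∏ c ∈ tᶜ, (1 - p c)) * (if D ⊆ t then 1 else 0) =
      ∏ c ∈ D, p c := by
  have h := Fintype.prod_add p (fun c => if c ∈ D then 0 else 1 - p c)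
  have hl : ∏ c, (p c + if c ∈ D then 0 else 1 - p c) = ∏ c ∈ D, p c := by
    rw [← Finset.prod_mul_prod_compl D]
    rw [Finset.prod_congr rfl fun c (hc : c ∈ D) => by rw [if_pos hc, add_zero],
      Finset.prod_congr rfl fun c (hc : c ∈ Dᶜ) => by
        rw [if_neg (Finset.mem_compl.1 hc), add_sub_cancel]]
    rw [Finset.prod_const_one, mul_one]
  rw [hl] at h
  rw [h]
  refine Finset.sum_congr rfl fun t _ => ?_
  by_cases hD : D ⊆ t
  · rw [if_pos hD, mul_one, Finset.prod_congr rfl fun c (hc : c ∈ tᶜ) =>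
      if_neg fun hcD => Finset.mem_compl.1 hc (hD hcD)]
  · rw [if_neg hD, mul_zero]
    obtain ⟨c, hcD, hct⟩ := Finset.not_subset.1 hD
    have h0 : (∏ c ∈ tᶜ, if c ∈ D then (0 : ℝ) else 1 - p c) = 0 :=
      Finset.prod_eq_zero (Finset.mem_compl.2 hct) (by rw [if_pos hcD])
    rw [h0, mul_zero]

/-- The Bernoulli product weights sum to `1`. [folklore] -/
theorem sum_bernoulliWeight (p : C → ℝ) :
    ∑ t : Finset C, (∏ c ∈ t, p c) * ∏ c ∈ tᶜ, (1 - p c) = 1 := by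
  have h := sum_bernoulliWeight_superset p ∅
  simpa using h

/-- **No doubly occupied pair under a Bernoulli product measure.** For a family of pairwise disjoint
pairs of distinct coordinates `{u e, v e}`, `e ∈ T`, the probability that no pair is fully occupied
is `Π_{e ∈ T} (1 - p(u e) p(v e))` (inclusion–exclusion and the marginal formula).
[cite: Sly2010, Lemma 2.2 (proof: "the spins … are … conditionally independent … It follows that …")] -/
theorem sum_bernoulliWeight_noPair (p : C → ℝ) {E : Type*} (T : Finset E) (u v : E → C)
    (hu : Set.InjOn u T) (hv : Set.InjOn v T) (huv : ∀ e ∈ T, ∀ e' ∈ T, u e ≠ v e') :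
    ∑ t : Finset C, ((∏ c ∈ t, p c) * ∏ c ∈ tᶜ, (1 - p c)) *
        (if ∀ e ∈ T, ¬ (u e ∈ t ∧ v e ∈ t) then 1 else 0) =
      ∏ e ∈ T, (1 - p (u e) * p (v e)) := by
  classical
  -- both sides equal `Σ_{T' ⊆ T} (-1)^{|T'|} Π_{e ∈ T'} p(u e) p(v e)`
  have hR : ∏ e ∈ T, (1 - p (u e) * p (v e)) =
      ∑ T' ∈ T.powerset, (-1) ^ T'.card * ∏ e ∈ T', p (u e) * p (v e) := by
    simp_rw [sub_eq_add_neg]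
    rw [Finset.prod_one_add]
    refine Finset.sum_congr rfl fun T' _ => ?_
    rw [Finset.prod_neg]
  -- the indicator of "no pair occupied" expanded by inclusion–exclusion
  have hI : ∀ t : Finset C, (if ∀ e ∈ T, ¬ (u e ∈ t ∧ v e ∈ t) then (1 : ℝ) else 0) =
      ∑ T' ∈ T.powerset, (-1) ^ T'.card * (if ∀ e ∈ T', u e ∈ t ∧ v e ∈ t then 1 else 0) := by
    intro t
    have h1 : (if ∀ e ∈ T, ¬ (u e ∈ t ∧ v e ∈ t) then (1 : ℝ) else 0) =
        ∏ e ∈ T, (1 + -(if u e ∈ t ∧ v e ∈ t then (1 : ℝ) else 0)) := by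
      rw [← Finset.prod_boole]
      refine Finset.prod_congr rfl fun e _ => ?_
      split_ifs <;> norm_num
    rw [h1, Finset.prod_one_add]
    refine Finset.sum_congr rfl fun T' _ => ?_
    rw [Finset.prod_neg, Finset.prod_boole]
  -- the marginal of the union of the pairs in `T'`
  have hM : ∀ T' ∈ T.powerset,
      ∑ t : Finset C, ((∏ c ∈ t, p c) * ∏ c ∈ tᶜ, (1 - p c)) *
          (if ∀ e ∈ T', u e ∈ t ∧ v e ∈ t then 1 else 0) = ∏ e ∈ T', p (u e) * p (v e) := by
    intro T' hT'
    have hT'T : T' ⊆ T := Finset.mem_powerset.1 hT'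
    have hsub : ∀ t : Finset C, (∀ e ∈ T', u e ∈ t ∧ v e ∈ t) ↔ T'.image u ∪ T'.image v ⊆ t := by
      intro t
      simp only [Finset.union_subset_iff, Finset.image_subset_iff]
      exact ⟨fun h => ⟨fun e he => (h e he).1, fun e he => (h e he).2⟩,
        fun h e he => ⟨h.1 e he, h.2 e he⟩⟩
    simp_rw [hsub]
    rw [sum_bernoulliWeight_superset, Finset.prod_union, Finset.prod_image (hu.mono hT'T),
      Finset.prod_image (hv.mono hT'T), ← Finset.prod_mul_distrib]
    rw [Finset.disjoint_left]
    rintro c hcu hcv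
    obtain ⟨e, he, rfl⟩ := Finset.mem_image.1 hcu
    obtain ⟨e', he', h'⟩ := Finset.mem_image.1 hcv
    exact huv e (hT'T he) e' (hT'T he') h'.symm
  simp_rw [hI, Finset.mul_sum]
  rw [Finset.sum_comm, hR]
  refine Finset.sum_congr rfl fun T' hT' => ?_
  rw [← hM T' hT', Finset.mul_sum]
  refine Finset.sum_congr rfl fun t _ => ?_
  ring

end SlyReduction

end Bernoulli

section PortSums

variable {W : Type*} [Fintype W] [DecidableEq W]

omit [Fintype W] in
/-- The `x`-fibre of a configuration of `Fin N × W` has as many elements as the configuration has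
points over `x`. [folklore] -/
theorem card_filter_fst_eq_card_copyFiber {N : ℕ} (I : Finset (Fin N × W)) (x : Fin N) :
    (I.filter fun a => a.1 = x).card = (copyFiber I x).card := by
  rw [copyFiber, Finset.card_image_of_injOn]
  rintro ⟨x₁, a₁⟩ h₁ ⟨x₂, a₂⟩ h₂ (h : a₁ = a₂)
  simp only [Finset.coe_filter, Set.mem_setOf_eq] at h₁ h₂
  exact Prod.ext (h₁.2.trans h₂.2.symm) h

omit [Fintype W] in
/-- Fibres of the complement are complements of fibres. [folklore] -/
theorem copyFiber_compl [Fintype W] {N : ℕ} (I : Finset (Fin N × W)) (x : Fin N) :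
    copyFiber Iᶜ x = (copyFiber I x)ᶜ := by
  ext a
  simp [mem_copyFiber]

omit [Fintype W] in
/-- A product over a configuration of a weight depending only on the copy index.
[folklore] -/
theorem prod_eq_prod_pow_card_copyFiber {N : ℕ} (I : Finset (Fin N × W))
    (a : Fin N → ℝ) : ∏ c ∈ I, a c.1 = ∏ x, a x ^ (copyFiber I x).card := by
  rw [← Finset.prod_fiberwise' I Prod.fst a]
  refine Finset.prod_congr rfl fun x _ => ?_
  rw [Finset.prod_const, card_filter_fst_eq_card_copyFiber]

open scoped Classical in
/-- **One side of the port computation.** For occupation probabilities `a x` on the `m` ports of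
copy `x` and a set `D` of oriented edges of `H` (each edge oriented once), the total Bernoulli
weight of the port-occupation families `S` in which no new edge `(x, ι(y,j)) ∼ (y, ι(x,j))`,
`xy ∈ E(H)`, `j < κ`, is doubly occupied equals `Π_{(x,y) ∈ D} (1 - a_x a_y)^κ`.
[cite: Sly2010, Lemma 2.2 (proof, the display following "by direct calculations")] -/
theorem sum_portFamilies_noPair {N κ m : ℕ} (H : SimpleGraph (Fin N)) (ι : Fin N × Fin κ ↪ Fin m)
    (a : Fin N → ℝ) (D : Finset (Fin N × Fin N))
    (hD : ∀ x y, H.Adj x y ↔ ((x, y) ∈ D ∨ (y, x) ∈ D)) (hD' : ∀ x y, (x, y) ∈ D → (y, x) ∉ D) :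
    ∑ S : Fin N → Finset (Fin m),
      (if ∀ x y, H.Adj x y → ∀ j : Fin κ, ¬ (ι (y, j) ∈ S x ∧ ι (x, j) ∈ S y) then
        ∏ x, a x ^ (S x).card * (1 - a x) ^ (m - (S x).card) else 0) =
      ∏ e ∈ D, (1 - a e.1 * a e.2) ^ κ := by
  classical
  -- pass to configurations `t ⊆ Fin N × Fin m` of all ports
  rw [← sum_eq_sum_copyFiber (V := Fin m) (f := fun S : Fin N → Finset (Fin m) =>
    if ∀ x y, H.Adj x y → ∀ j : Fin κ, ¬ (ι (y, j) ∈ S x ∧ ι (x, j) ∈ S y) then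
      ∏ x, a x ^ (S x).card * (1 - a x) ^ (m - (S x).card) else 0)]
  -- the slots: `((x, y), j)` with `(x, y) ∈ D`, `j < κ`
  have key := SlyReduction.sum_bernoulliWeight_noPair (fun c : Fin N × Fin m => a c.1) (D ×ˢ (Finset.univ : Finset (Fin κ)))
    (fun e : (Fin N × Fin N) × Fin κ => (e.1.1, ι (e.1.2, e.2)))
    (fun e : (Fin N × Fin N) × Fin κ => (e.1.2, ι (e.1.1, e.2))) ?_ ?_ ?_
  · rw [Finset.prod_product] at key
    simp only [Finset.prod_const, Finset.card_univ, Fintype.card_fin] at key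
    rw [← key]
    · dsimp only
      refine Finset.sum_congr rfl fun t _ => ?_
      -- the constraint
      have hc : (∀ x y, H.Adj x y → ∀ j : Fin κ,
            ¬ (ι (y, j) ∈ copyFiber t x ∧ ι (x, j) ∈ copyFiber t y)) ↔
          ∀ e ∈ D ×ˢ (Finset.univ : Finset (Fin κ)),
            ¬ ((e.1.1, ι (e.1.2, e.2)) ∈ t ∧ (e.1.2, ι (e.1.1, e.2)) ∈ t) := by
        simp only [mem_copyFiber, Finset.mem_product, Finset.mem_univ, and_true, Prod.forall]
        constructor
        · intro h x y j hxy
          exact h x y ((hD x y).2 (Or.inl hxy)) j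
        · intro h x y hxy j
          rcases (hD x y).1 hxy with h1 | h1
          · exact h x y j h1
          · exact fun h2 => h y x j h1 ⟨h2.2, h2.1⟩
      -- the weights
      have hw : ∏ x, a x ^ (copyFiber t x).card * (1 - a x) ^ (m - (copyFiber t x).card) =
          (∏ c ∈ t, a c.1) * ∏ c ∈ tᶜ, (1 - a c.1) := by
        rw [prod_eq_prod_pow_card_copyFiber, prod_eq_prod_pow_card_copyFiber tᶜ (fun x => 1 - a x),
          ← Finset.prod_mul_distrib]
        refine Finset.prod_congr rfl fun x _ => ?_
        rw [copyFiber_compl, Finset.card_compl, Fintype.card_fin]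
      by_cases h : ∀ x y, H.Adj x y → ∀ j : Fin κ, ¬ (ι (y, j) ∈ copyFiber t x ∧ ι (x, j) ∈ copyFiber t y)
      · rw [if_pos h, if_pos (hc.1 h), mul_one, hw]
      · rw [if_neg h, if_neg (fun h' => h (hc.2 h')), mul_zero]
  · -- injectivity of `u`
    rintro ⟨⟨x, y⟩, j⟩ - ⟨⟨x', y'⟩, j'⟩ - h
    simp only [Prod.mk.injEq] at h
    obtain ⟨rfl, h2⟩ := h
    have := ι.injective h2
    simp only [Prod.mk.injEq] at this
    obtain ⟨rfl, rfl⟩ := this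
    rfl
  · -- injectivity of `v`
    rintro ⟨⟨x, y⟩, j⟩ - ⟨⟨x', y'⟩, j'⟩ - h
    simp only [Prod.mk.injEq] at h
    obtain ⟨rfl, h2⟩ := h
    have := ι.injective h2
    simp only [Prod.mk.injEq] at this
    obtain ⟨rfl, rfl⟩ := this
    rfl
  · -- `u e ≠ v e'`
    rintro ⟨⟨x, y⟩, j⟩ he ⟨⟨x', y'⟩, j'⟩ he' h
    simp only [Prod.mk.injEq] at h
    obtain ⟨rfl, h2⟩ := h
    have := ι.injective h2
    simp only [Prod.mk.injEq] at this
    obtain ⟨rfl, rfl⟩ := this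
    simp only [Finset.mem_product, Finset.mem_univ, and_true] at he he'
    exact hD' _ _ he he'

end PortSums

section PortIdentity

namespace SlyReduction

open scoped Classical in
/-- The ordered adjacent pairs of a graph on `Fin N` number `Σ_x deg(x) = 2 |E(H)|`. [folklore] -/
theorem card_filter_adj_eq {N : ℕ} (H : SimpleGraph (Fin N)) :
    ((Finset.univ : Finset (Fin N × Fin N)).filter fun e => H.Adj e.1 e.2).card =
      2 * H.edgeFinset.card := by
  rw [← H.sum_degrees_eq_twice_card_edges, card_eq_sum_card_copyFiber]
  refine Finset.sum_congr rfl fun x _ => ?_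
  rw [← SimpleGraph.card_neighborFinset_eq_degree]
  congr 1
  ext a
  simp [mem_copyFiber]

open scoped Classical in
/-- A set `D` of ordered pairs orienting every edge of `H` exactly once has `|E(H)|` elements.
[folklore] -/
theorem card_eq_card_edgeFinset_of_orient {N : ℕ} (H : SimpleGraph (Fin N)) (D : Finset (Fin N × Fin N))
    (hD : ∀ x y, H.Adj x y ↔ ((x, y) ∈ D ∨ (y, x) ∈ D)) (hD' : ∀ x y, (x, y) ∈ D → (y, x) ∉ D) :
    D.card = H.edgeFinset.card := by
  have hA : ((Finset.univ : Finset (Fin N × Fin N)).filter fun e => H.Adj e.1 e.2) =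
      D ∪ D.map (Equiv.prodComm (Fin N) (Fin N)).toEmbedding := by
    ext ⟨x, y⟩
    simp only [Finset.mem_filter, Finset.mem_univ, true_and, Finset.mem_union, Finset.mem_map_equiv,
      Equiv.prodComm_symm, Equiv.prodComm_apply, Prod.swap_prod_mk]
    exact hD x y
  have hdisj : Disjoint D (D.map (Equiv.prodComm (Fin N) (Fin N)).toEmbedding) := by
    rw [Finset.disjoint_left]
    rintro ⟨x, y⟩ h1 h2
    rw [Finset.mem_map_equiv, Equiv.prodComm_symm, Equiv.prodComm_apply, Prod.swap_prod_mk] at h2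
    exact hD' x y h1 h2
  have h2 := card_filter_adj_eq H
  rw [hA, Finset.card_union_of_disjoint hdisj, Finset.card_map] at h2
  omega

end SlyReduction

open scoped Classical in
/-- **The port computation of Sly's Lemma 2.2.** Under the product measures `Q^{𝒴'_x}` on the ports
of the copies (occupation probability `q⁺` on `V⁺_x` and `q⁻` on `V⁻_x` in phase `+`, swapped in
phase `−`), the probability that none of the `2κ|E(H)|` new edges of `H^G` is doubly occupied is
exactly `C_H · B^{κ Cut(𝒴')}`: an uncut edge contributes `((1-(q⁺)²)(1-(q⁻)²))^κ`, a cut edge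
`((1-q⁺q⁻)²)^κ`. [cite: Sly2010, Lemma 2.2 (proof, last two displays)] -/
theorem sum_patterns_portLaw {N κ m : ℕ} (H : SimpleGraph (Fin N)) (ι : Fin N × Fin κ ↪ Fin m)
    {qp qm : ℝ} (hq : (1 - qp ^ 2) * (1 - qm ^ 2) ≠ 0) (Y : Fin N → Bool) :
    ∑ P : Fin N → Finset (Fin m) × Finset (Fin m),
      (if ∀ x y, H.Adj x y → ∀ j : Fin κ,
          ¬ (ι (y, j) ∈ (P x).1 ∧ ι (x, j) ∈ (P y).1) ∧ ¬ (ι (y, j) ∈ (P x).2 ∧ ι (x, j) ∈ (P y).2)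
        then ∏ x, portLaw (if Y x then qp else qm) (if Y x then qm else qp) m (P x) else 0) =
      slyC qp qm κ H.edgeFinset.card * slyB qp qm ^ (κ * cutSize H Y) := by
  -- orient every edge once: cut edges from `+` to `−`, uncut edges upwards
  set D : Finset (Fin N × Fin N) := Finset.univ.filter fun e =>
    H.Adj e.1 e.2 ∧ ((Y e.1 = true ∧ Y e.2 = false) ∨ (Y e.1 = Y e.2 ∧ e.1 < e.2)) with hDdef
  have hmemD : ∀ x y, (x, y) ∈ D ↔ H.Adj x y ∧ ((Y x = true ∧ Y y = false) ∨ (Y x = Y y ∧ x < y)) := by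
    intro x y
    rw [hDdef, Finset.mem_filter]
    simp
  have hD : ∀ x y, H.Adj x y ↔ ((x, y) ∈ D ∨ (y, x) ∈ D) := by
    intro x y
    rw [hmemD, hmemD]
    constructor
    · intro h
      have hne : x ≠ y := H.ne_of_adj h
      rcases lt_or_gt_of_ne hne with hlt | hlt <;> cases hx : Y x <;> cases hy : Y y <;>
        simp [h, h.symm, hlt]
    · rintro (h | h)
      · exact h.1
      · exact h.1.symm
  have hD' : ∀ x y, (x, y) ∈ D → (y, x) ∉ D := by
    intro x y h1 h2
    rw [hmemD] at h1 h2
    rcases h1.2 with h1 | h1 <;> rcases h2.2 with h2 | h2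
    · rw [h1.1] at h2; exact Bool.noConfusion h2.2
    · rw [h1.1, h1.2] at h2; exact Bool.noConfusion h2.1
    · rw [h2.1, h2.2] at h1; exact Bool.noConfusion h1.1
    · exact lt_asymm h1.2 h2.2
  -- split the two sides
  have hsplit : ∀ P : Fin N → Finset (Fin m) × Finset (Fin m),
      (∀ x y, H.Adj x y → ∀ j : Fin κ,
          ¬ (ι (y, j) ∈ (P x).1 ∧ ι (x, j) ∈ (P y).1) ∧ ¬ (ι (y, j) ∈ (P x).2 ∧ ι (x, j) ∈ (P y).2)) ↔
        (∀ x y, H.Adj x y → ∀ j : Fin κ, ¬ (ι (y, j) ∈ (P x).1 ∧ ι (x, j) ∈ (P y).1)) ∧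
          ∀ x y, H.Adj x y → ∀ j : Fin κ, ¬ (ι (y, j) ∈ (P x).2 ∧ ι (x, j) ∈ (P y).2) :=
    fun P => ⟨fun h => ⟨fun x y hxy j => (h x y hxy j).1, fun x y hxy j => (h x y hxy j).2⟩,
      fun h x y hxy j => ⟨h.1 x y hxy j, h.2 x y hxy j⟩⟩
  set ap : Fin N → ℝ := fun x => if Y x then qp else qm with hap
  set am : Fin N → ℝ := fun x => if Y x then qm else qp with ham
  have hL : ∑ P : Fin N → Finset (Fin m) × Finset (Fin m),
      (if ∀ x y, H.Adj x y → ∀ j : Fin κ,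
          ¬ (ι (y, j) ∈ (P x).1 ∧ ι (x, j) ∈ (P y).1) ∧ ¬ (ι (y, j) ∈ (P x).2 ∧ ι (x, j) ∈ (P y).2)
        then ∏ x, portLaw (if Y x then qp else qm) (if Y x then qm else qp) m (P x) else 0) =
      (∑ S : Fin N → Finset (Fin m),
        (if ∀ x y, H.Adj x y → ∀ j : Fin κ, ¬ (ι (y, j) ∈ S x ∧ ι (x, j) ∈ S y) then
          ∏ x, ap x ^ (S x).card * (1 - ap x) ^ (m - (S x).card) else 0)) *
      ∑ S : Fin N → Finset (Fin m),
        (if ∀ x y, H.Adj x y → ∀ j : Fin κ, ¬ (ι (y, j) ∈ S x ∧ ι (x, j) ∈ S y) then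
          ∏ x, am x ^ (S x).card * (1 - am x) ^ (m - (S x).card) else 0) := by
    rw [Finset.sum_mul_sum, ← Finset.sum_product', Finset.univ_product_univ,
      ← Fintype.sum_equiv (Equiv.arrowProdEquivProdArrow (Fin N) (fun _ => Finset (Fin m))
        (fun _ => Finset (Fin m))).symm]
    intro S
    simp only [Equiv.arrowProdEquivProdArrow, Equiv.coe_fn_symm_mk]
    by_cases h1 : ∀ x y, H.Adj x y → ∀ j : Fin κ, ¬ (ι (y, j) ∈ S.1 x ∧ ι (x, j) ∈ S.1 y)
    · by_cases h2 : ∀ x y, H.Adj x y → ∀ j : Fin κ, ¬ (ι (y, j) ∈ S.2 x ∧ ι (x, j) ∈ S.2 y)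
      · rw [if_pos h1, if_pos h2, if_pos (fun x y hxy j => ⟨h1 x y hxy j, h2 x y hxy j⟩),
          ← Finset.prod_mul_distrib]
        rfl
      · rw [if_neg h2, if_neg (show ¬ (∀ x y, H.Adj x y → ∀ j : Fin κ,
            ¬ (ι (y, j) ∈ S.1 x ∧ ι (x, j) ∈ S.1 y) ∧ ¬ (ι (y, j) ∈ S.2 x ∧ ι (x, j) ∈ S.2 y)) from
          fun h => h2 fun x y hxy j => (h x y hxy j).2), mul_zero]
    · rw [if_neg h1, if_neg (show ¬ (∀ x y, H.Adj x y → ∀ j : Fin κ,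
          ¬ (ι (y, j) ∈ S.1 x ∧ ι (x, j) ∈ S.1 y) ∧ ¬ (ι (y, j) ∈ S.2 x ∧ ι (x, j) ∈ S.2 y)) from
        fun h => h1 fun x y hxy j => (h x y hxy j).1), zero_mul]
  rw [hL, sum_portFamilies_noPair H ι ap D hD hD', sum_portFamilies_noPair H ι am D hD hD',
    ← Finset.prod_mul_distrib]
  -- evaluate the factor of each oriented edge
  have hfac : ∀ e ∈ D, (1 - ap e.1 * ap e.2) ^ κ * (1 - am e.1 * am e.2) ^ κ =
      if Y e.1 = Y e.2 then ((1 - qp ^ 2) * (1 - qm ^ 2)) ^ κ else ((1 - qp * qm) ^ 2) ^ κ := by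
    rintro ⟨x, y⟩ -
    simp only [hap, ham]
    rw [← mul_pow]
    cases Y x <;> cases Y y <;> simp <;> ring
  rw [Finset.prod_congr rfl hfac, Finset.prod_ite, Finset.prod_const, Finset.prod_const]
  -- count the two kinds of edges
  have hcut : (D.filter fun e => ¬ Y e.1 = Y e.2).card = cutSize H Y := by
    rw [cutSize]
    congr 1
    ext ⟨x, y⟩
    simp only [Finset.mem_filter, hmemD, Finset.mem_univ, true_and]
    cases Y x <;> cases Y y <;> simp
  have hsum : (D.filter fun e => Y e.1 = Y e.2).card + cutSize H Y = H.edgeFinset.card := by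
    rw [← hcut, Finset.card_filter_add_card_filter_not,
      SlyReduction.card_eq_card_edgeFinset_of_orient H D hD hD']
  rw [hcut, ← hsum, slyC, slyB]
  have hw : ((1 - qp ^ 2) * (1 - qm ^ 2)) ^ (κ * cutSize H Y) ≠ 0 := pow_ne_zero _ hq
  rw [div_pow]
  field_simp
  ring

end PortIdentity

section PatternDecomposition

variable {V : Type*} [Fintype V] [DecidableEq V]

omit [Fintype V] in
/-- Membership in the `+`-component of the port configuration. [folklore] -/
theorem mem_portPattern_fst {m : ℕ} (Vp Vm : Fin m ↪ V) (S : Finset V) (i : Fin m) :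
    i ∈ (portPattern Vp Vm S).1 ↔ Vp i ∈ S := by
  simp [portPattern]

omit [Fintype V] in
/-- Membership in the `−`-component of the port configuration. [folklore] -/
theorem mem_portPattern_snd {m : ℕ} (Vp Vm : Fin m ↪ V) (S : Finset V) (i : Fin m) :
    i ∈ (portPattern Vp Vm S).2 ↔ Vm i ∈ S := by
  simp [portPattern]

omit [Fintype V] [DecidableEq V] in
/-- Pulling an indicator through a sum. [folklore] -/
theorem SlyReduction.ite_sum_zero {α M : Type*} [AddCommMonoid M] (s : Finset α) (f : α → M) (c : Prop)
    [Decidable c] : (if c then ∑ i ∈ s, f i else 0) = ∑ i ∈ s, (if c then f i else 0) := by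
  split_ifs <;> simp

open scoped Classical in
/-- **Products of restricted partition functions of `G` over the copies** are sums over the
configurations of `Fin N × V` whose fibres are independent and satisfy the respective events.
[folklore] -/
theorem prod_hardcoreZOn_eq_sum {N : ℕ} (G : SimpleGraph V) (lam : ℝ) (E : Fin N → Finset V → Prop) :
    ∏ x, hardcoreZOn G lam (E x) =
      ∑ I : Finset (Fin N × V),
        (if ∀ x, G.IsIndepSet (↑(copyFiber I x) : Set V) ∧ E x (copyFiber I x) then lam ^ I.card else 0) := by
  simp only [hardcoreZOn_def]
  rw [Fintype.prod_sum, ← sum_eq_sum_copyFiber]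
  refine Finset.sum_congr rfl fun I _ => ?_
  dsimp only
  by_cases h : ∀ x, G.IsIndepSet (↑(copyFiber I x) : Set V) ∧ E x (copyFiber I x)
  · rw [if_pos h, Finset.prod_congr rfl fun x _ => if_pos (h x), Finset.prod_pow_eq_pow_sum,
      card_eq_sum_card_copyFiber]
  · rw [if_neg h]
    obtain ⟨x, hx⟩ := not_forall.1 h
    exact Finset.prod_eq_zero (Finset.mem_univ x) (if_neg hx)

open scoped Classical in
/-- **`Z_{H^G}(λ; 𝒴 = 𝒴')` decomposed along the port configurations of the copies**: grouping the
independent sets of `H^G` with phase vector `𝒴'` by the family `(σ_{V_x})_{x ∈ H}` of their port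
configurations, `Z_{H^G}(𝒴') = Σ_{(S_x)_x admissible} Π_x Z_G(λ; Y = 𝒴'_x, σ_V = S_x)`, where a family
is admissible iff no new edge of `H^G` joins two occupied ports ("the ratio … is exactly the
probability that the configuration `σ` sampled under `P_{Ĥ^G}` is also an independent set for `H^G`
after adding in the extra edges"). [cite: Sly2010, Lemma 2.2 (proof, second and third displays)] -/
theorem hardcoreZOn_gadgetSubst_phaseVec_eq_sum {N κ m : ℕ} (H : SimpleGraph (Fin N))
    (G : SimpleGraph V) (Vp Vm : Fin m ↪ V) (ι : Fin N × Fin κ ↪ Fin m) (lam : ℝ)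
    (Wp Wm : Finset V) (Y : Fin N → Bool) :
    hardcoreZOn (gadgetSubst H G Vp Vm ι) lam (fun I => phaseVec Wp Wm I = Y) =
      ∑ P : Fin N → Finset (Fin m) × Finset (Fin m),
        (if ∀ x y, H.Adj x y → ∀ j : Fin κ,
            ¬ (ι (y, j) ∈ (P x).1 ∧ ι (x, j) ∈ (P y).1) ∧ ¬ (ι (y, j) ∈ (P x).2 ∧ ι (x, j) ∈ (P y).2)
          then ∏ x, hardcoreZOn G lam (fun S => slyPhase Wp Wm S = Y x ∧ portPattern Vp Vm S = P x)
          else 0) := by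
  rw [hardcoreZOn_def (gadgetSubst H G Vp Vm ι)]
  simp_rw [prod_hardcoreZOn_eq_sum, SlyReduction.ite_sum_zero]
  rw [Finset.sum_comm]
  refine Finset.sum_congr rfl fun I _ => ?_
  have hiff := isIndepSet_gadgetSubst_iff H G Vp Vm ι I
  have hok : (∀ x y, H.Adj x y → ∀ j : Fin κ,
      ¬ ((x, Vp (ι (y, j))) ∈ I ∧ (y, Vp (ι (x, j))) ∈ I) ∧
        ¬ ((x, Vm (ι (y, j))) ∈ I ∧ (y, Vm (ι (x, j))) ∈ I)) ↔
      ∀ x y, H.Adj x y → ∀ j : Fin κ,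
        ¬ (ι (y, j) ∈ (portPattern Vp Vm (copyFiber I x)).1 ∧
            ι (x, j) ∈ (portPattern Vp Vm (copyFiber I y)).1) ∧
          ¬ (ι (y, j) ∈ (portPattern Vp Vm (copyFiber I x)).2 ∧
            ι (x, j) ∈ (portPattern Vp Vm (copyFiber I y)).2) := by
    simp only [mem_portPattern_fst, mem_portPattern_snd, mem_copyFiber]
  -- only the family of port configurations of `I` itself contributes
  symm
  rw [Finset.sum_eq_single (fun x => portPattern Vp Vm (copyFiber I x))]
  · -- the main term
    by_cases hB : ∀ x y, H.Adj x y → ∀ j : Fin κ,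
        ¬ (ι (y, j) ∈ (portPattern Vp Vm (copyFiber I x)).1 ∧
            ι (x, j) ∈ (portPattern Vp Vm (copyFiber I y)).1) ∧
          ¬ (ι (y, j) ∈ (portPattern Vp Vm (copyFiber I x)).2 ∧
            ι (x, j) ∈ (portPattern Vp Vm (copyFiber I y)).2)
    · rw [if_pos hB]
      by_cases hA : ∀ x, G.IsIndepSet (↑(copyFiber I x) : Set V) ∧ slyPhase Wp Wm (copyFiber I x) = Y x
      · have h1 : (gadgetSubst H G Vp Vm ι).IsIndepSet (↑I : Set (Fin N × V)) ∧ phaseVec Wp Wm I = Y :=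
          ⟨hiff.2 ⟨fun x => (hA x).1, hok.2 hB⟩, funext fun x => (hA x).2⟩
        rw [if_pos h1, if_pos (fun x => ⟨(hA x).1, (hA x).2, rfl⟩)]
      · have h1 : ¬ ((gadgetSubst H G Vp Vm ι).IsIndepSet (↑I : Set (Fin N × V)) ∧ phaseVec Wp Wm I = Y) :=
          fun h => hA fun x => ⟨(hiff.1 h.1).1 x, by rw [← h.2]; rfl⟩
        rw [if_neg h1, if_neg (fun h => hA fun x => ⟨(h x).1, (h x).2.1⟩)]
    · rw [if_neg hB]
      have h1 : ¬ ((gadgetSubst H G Vp Vm ι).IsIndepSet (↑I : Set (Fin N × V)) ∧ phaseVec Wp Wm I = Y) :=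
        fun h => hB (hok.1 (hiff.1 h.1).2)
      rw [if_neg h1]
  · -- other families do not occur
    intro P _ hP
    obtain ⟨x, hx⟩ : ∃ x, P x ≠ portPattern Vp Vm (copyFiber I x) := by
      by_contra h
      push Not at h
      exact hP (funext h)
    rw [if_neg (show ¬ (∀ x, G.IsIndepSet (↑(copyFiber I x) : Set V) ∧
        (slyPhase Wp Wm (copyFiber I x) = Y x ∧ portPattern Vp Vm (copyFiber I x) = P x)) from
      fun h => hx (h x).2.2.symm)]
    exact ite_self 0
  · exact fun h => (h (Finset.mem_univ _)).elim

end PatternDecomposition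

section CutProb

variable {V : Type*} [Fintype V] [DecidableEq V]

/-- `Q_V^{±}(S) ≥ 0` for parameters in `[0, 1]`. [folklore] -/
theorem portLaw_nonneg {a b : ℝ} (ha : 0 ≤ a) (ha1 : a ≤ 1) (hb : 0 ≤ b) (hb1 : b ≤ 1) (m : ℕ)
    (S : Finset (Fin m) × Finset (Fin m)) : 0 ≤ portLaw a b m S := by
  unfold portLaw
  have h1 : 0 ≤ 1 - a := sub_nonneg.2 ha1
  have h2 : 0 ≤ 1 - b := sub_nonneg.2 hb1
  positivity

open scoped Classical in
/-- **`(cutProb)` with explicit error**: if the gadget satisfies `(GpropB)` with error `δ ∈ [0, 1]`,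
then for every `H` on `N` vertices, every port reservation and every phase vector `𝒴'`,
`(1-δ)^N · C_H B^{κ Cut(𝒴')} Z_{Ĥ^G}(𝒴') ≤ Z_{H^G}(𝒴') ≤ (1+δ)^N · C_H B^{κ Cut(𝒴')} Z_{Ĥ^G}(𝒴')`
(Sly: the conditional port laws are within `1 ± δ` of the product measures `Q^{𝒴'_x}`, copy by copy,
and under the product measures the no-conflict probability is exactly `C_H B^{κ Cut(𝒴')}`).
[cite: Sly2010, Lemma 2.2 (second display) and its proof] -/
theorem cutProb_bounds_of_slyPropB {N κ m : ℕ} (H : SimpleGraph (Fin N)) (G : SimpleGraph V)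
    (Vp Vm : Fin m ↪ V) (ι : Fin N × Fin κ ↪ Fin m) {lam : ℝ} (hlam : 0 ≤ lam) (Wp Wm : Finset V)
    {qp qm δ : ℝ} (hqm : 0 < qm) (hlt : qm < qp) (hqp : qp < 1) (hδ1 : δ ≤ 1)
    (hB : SlyPropB G lam Wp Wm Vp Vm qp qm δ) (Y : Fin N → Bool) :
    (1 - δ) ^ N * (slyC qp qm κ H.edgeFinset.card * slyB qp qm ^ (κ * cutSize H Y) *
        hardcoreZOn (gadgetSubst ⊥ G Vp Vm ι) lam (fun I => phaseVec Wp Wm I = Y)) ≤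
      hardcoreZOn (gadgetSubst H G Vp Vm ι) lam (fun I => phaseVec Wp Wm I = Y) ∧
    hardcoreZOn (gadgetSubst H G Vp Vm ι) lam (fun I => phaseVec Wp Wm I = Y) ≤
      (1 + δ) ^ N * (slyC qp qm κ H.edgeFinset.card * slyB qp qm ^ (κ * cutSize H Y) *
        hardcoreZOn (gadgetSubst ⊥ G Vp Vm ι) lam (fun I => phaseVec Wp Wm I = Y)) := by
  have hq : (1 - qp ^ 2) * (1 - qm ^ 2) ≠ 0 := by
    have h1 : 0 < 1 - qp ^ 2 := by nlinarith
    have h2 : 0 < 1 - qm ^ 2 := by nlinarith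
    positivity
  rw [hardcoreZOn_gadgetSubst_phaseVec_eq_sum H, hardcoreZOn_gadgetSubst_bot_phaseVec,
    ← sum_patterns_portLaw H ι hq Y, Finset.sum_mul, Finset.mul_sum, Finset.mul_sum]
  -- the termwise comparison supplied by `(GpropB)`
  have hterm : ∀ (x : Fin N) (P : Fin N → Finset (Fin m) × Finset (Fin m)),
      (1 - δ) * (portLaw (if Y x then qp else qm) (if Y x then qm else qp) m (P x) *
          hardcoreZOn G lam (fun S => slyPhase Wp Wm S = Y x)) ≤
        hardcoreZOn G lam (fun S => slyPhase Wp Wm S = Y x ∧ portPattern Vp Vm S = P x) ∧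
      hardcoreZOn G lam (fun S => slyPhase Wp Wm S = Y x ∧ portPattern Vp Vm S = P x) ≤
        (1 + δ) * (portLaw (if Y x then qp else qm) (if Y x then qm else qp) m (P x) *
          hardcoreZOn G lam (fun S => slyPhase Wp Wm S = Y x)) :=
    fun x P => le_and_le_of_abs_sub_le (hB (Y x) (P x))
  have hQ : ∀ (x : Fin N) (P : Fin N → Finset (Fin m) × Finset (Fin m)),
      0 ≤ portLaw (if Y x then qp else qm) (if Y x then qm else qp) m (P x) := by
    intro x P
    cases Y x
    · exact portLaw_nonneg hqm.le (hlt.le.trans hqp.le) (hqm.le.trans hlt.le) hqp.le m (P x)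
    · exact portLaw_nonneg (hqm.le.trans hlt.le) hqp.le hqm.le (hlt.le.trans hqp.le) m (P x)
  have hZ : ∀ x : Fin N, 0 ≤ hardcoreZOn G lam (fun S => slyPhase Wp Wm S = Y x) :=
    fun x => hardcoreZOn_nonneg G hlam _
  constructor
  · refine Finset.sum_le_sum fun P _ => ?_
    split_ifs with hP
    · rw [mul_comm ((1 - δ) ^ N),
        show ((1 : ℝ) - δ) ^ N = ∏ _x : Fin N, (1 - δ) by simp, ← Finset.prod_mul_distrib,
        ← Finset.prod_mul_distrib]
      refine Finset.prod_le_prod (fun x _ => ?_) fun x _ => ?_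
      · exact mul_nonneg (mul_nonneg (hQ x P) (hZ x)) (by linarith)
      · have := (hterm x P).1
        linarith [this]
    · simp
  · refine Finset.sum_le_sum fun P _ => ?_
    split_ifs with hP
    · rw [mul_comm ((1 + δ) ^ N),
        show ((1 : ℝ) + δ) ^ N = ∏ _x : Fin N, (1 + δ) by simp, ← Finset.prod_mul_distrib,
        ← Finset.prod_mul_distrib]
      refine Finset.prod_le_prod (fun x _ => hardcoreZOn_nonneg G hlam _) fun x _ => ?_
      have := (hterm x P).2
      linarith [this]
    · simp

end CutProb

section Assembly

variable {V : Type*} [Fintype V] [DecidableEq V]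

open scoped Classical in
/-- **`(phaseProbs)` from `(GpropA)`**: `Z_{Ĥ^G}(λ; 𝒴 = 𝒴') = Π_x Z_G(λ; Y = 𝒴'_x) ≥ (Z_G(λ)/n)^N
= Z_{Ĥ^G}(λ)/n^N` ("the phases are independent and so … `≥ n^{-n^{θ/4}}`").
[cite: Sly2010, Lemma 2.2 (first display) and its proof] -/
theorem phaseProbs_of_slyPropA {N κ m : ℕ} (G : SimpleGraph V) (Vp Vm : Fin m ↪ V)
    (ι : Fin N × Fin κ ↪ Fin m) {lam : ℝ} (hlam : 0 ≤ lam) (Wp Wm : Finset V) {n : ℕ}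
    (hA : SlyPropA G lam Wp Wm n) (Y : Fin N → Bool) :
    independencePolynomial (gadgetSubst ⊥ G Vp Vm ι) lam / (n : ℝ) ^ N ≤
      hardcoreZOn (gadgetSubst ⊥ G Vp Vm ι) lam (fun I => phaseVec Wp Wm I = Y) := by
  rw [hardcoreZOn_gadgetSubst_bot_phaseVec, independencePolynomial_gadgetSubst_bot, ← div_pow]
  have hc : (independencePolynomial G lam / n) ^ N = ∏ _x : Fin N, independencePolynomial G lam / n := by
    rw [Finset.prod_const, Finset.card_univ, Fintype.card_fin]
  rw [hc]
  refine Finset.prod_le_prod (fun x _ => div_nonneg (independencePolynomial_pos G hlam).le n.cast_nonneg)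
    fun x _ => ?_
  cases Y x
  · exact hA.2
  · exact hA.1

/-- **The error terms of Lemma 2.2 are `o(1)`**: for `θ > 0`, `ε > 0` and all large `n`, every
`N ≤ n^{θ/4}` has `1 - ε ≤ (1 - n^{-2θ})^N` and `(1 + n^{-2θ})^N ≤ 1 + ε` (indeed
`N n^{-2θ} ≤ n^{-7θ/4} → 0`; Sly: "`2|E(H)| ≤ n^{θ/2}` factors `1 + O(n^{-θ})`").
[cite: Sly2010, Lemma 2.2 (proof, "(1+o(1))")] -/
theorem SlyReduction.eventually_pow_error_le {θ ε : ℝ} (hθ : 0 < θ) (hε : 0 < ε) :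
    ∃ n₀ : ℕ, ∀ n : ℕ, n₀ ≤ n → 0 < n ∧ (n : ℝ) ^ (-(2 * θ)) ≤ 1 ∧
      ∀ N : ℕ, (N : ℝ) ≤ (n : ℝ) ^ (θ / 4) →
        1 - ε ≤ (1 - (n : ℝ) ^ (-(2 * θ))) ^ N ∧ (1 + (n : ℝ) ^ (-(2 * θ))) ^ N ≤ 1 + ε := by
  have ht : Filter.Tendsto (fun n : ℕ => (n : ℝ) ^ (-(7 * θ / 4))) Filter.atTop (nhds 0) :=
    (tendsto_rpow_neg_atTop (by positivity)).comp tendsto_natCast_atTop_atTop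
  have h1 : ∀ᶠ n : ℕ in Filter.atTop, (n : ℝ) ^ (-(7 * θ / 4)) ≤ min (ε / 2) (1 / 2) :=
    ht.eventually_le_const (by positivity)
  have h2 : ∀ᶠ n : ℕ in Filter.atTop, 1 ≤ n := Filter.eventually_ge_atTop 1
  obtain ⟨n₀, hn₀⟩ := Filter.eventually_atTop.1 (h1.and h2)
  refine ⟨n₀, fun n hn => ?_⟩
  obtain ⟨hn1, hn2⟩ := hn₀ n hn
  have hnpos : (0 : ℝ) < n := by exact_mod_cast hn2
  have hn1' : (1 : ℝ) ≤ n := by exact_mod_cast hn2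
  set δ : ℝ := (n : ℝ) ^ (-(2 * θ)) with hδ
  have hδ0 : 0 ≤ δ := Real.rpow_nonneg hnpos.le _
  have hδ1 : δ ≤ 1 := Real.rpow_le_one_of_one_le_of_nonpos hn1' (by linarith)
  refine ⟨hn2, hδ1, fun N hN => ?_⟩
  -- `N δ ≤ n^{-7θ/4} ≤ min (ε/2) (1/2)`
  have hNδ : (N : ℝ) * δ ≤ min (ε / 2) (1 / 2) := by
    calc (N : ℝ) * δ ≤ (n : ℝ) ^ (θ / 4) * δ := mul_le_mul_of_nonneg_right hN hδ0
      _ = (n : ℝ) ^ (-(7 * θ / 4)) := by rw [hδ, ← Real.rpow_add hnpos]; ring_nf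
      _ ≤ min (ε / 2) (1 / 2) := hn1
  have hNδε : (N : ℝ) * δ ≤ ε / 2 := hNδ.trans (min_le_left _ _)
  have hNδ1 : (N : ℝ) * δ ≤ 1 / 2 := hNδ.trans (min_le_right _ _)
  have hNδ0 : 0 ≤ (N : ℝ) * δ := mul_nonneg N.cast_nonneg hδ0
  constructor
  · -- Bernoulli
    have hb := one_add_mul_le_pow (show (-2 : ℝ) ≤ -δ by linarith) N
    rw [← sub_eq_add_neg] at hb
    nlinarith [hb]
  · -- `(1 + δ)^N ≤ exp (N δ) ≤ 1 + 2 N δ`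
    have he : (1 + δ) ^ N ≤ Real.exp ((N : ℝ) * δ) := by
      rw [Real.exp_nat_mul]
      exact pow_le_pow_left₀ (by linarith) (by linarith [Real.add_one_le_exp δ]) N
    have habs : |Real.exp ((N : ℝ) * δ) - 1| ≤ 2 * |(N : ℝ) * δ| :=
      Real.abs_exp_sub_one_le (by rw [abs_of_nonneg hNδ0]; linarith)
    rw [abs_of_nonneg hNδ0] at habs
    have h3 := (abs_sub_le_iff.1 habs).1
    linarith

universe u in
open scoped Classical in
/-- **Sly 2010, Lemma 2.2** (the deterministic half of the gadget reduction), in the tree's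
vocabulary: there is `n₀ = n₀(θ, ε)` such that for `n ≥ n₀`, ANY gadget `(G, W^{±}, V^{±})` satisfying
`(GpropA)` at `n` and `(GpropB)` with `δ = n^{-2θ}` (`SlyPropA`, `SlyPropB`) satisfies the
conclusions `(phaseProbs)`, `(cutProb)` of Lemma 2.2 with relative error `ε` (`SlyCutEstimate`) for
every `N ≤ n^{θ/4}`, every `κ`, every graph `H` on `Fin N`, every port reservation `ι` and every
phase vector. Proof as printed: on `Ĥ^G` the copies are independent, so
`Z_{Ĥ^G}(𝒴') = Π_x Z_G(Y = 𝒴'_x) ≥ Z_{Ĥ^G}/n^N`; and `Z_{H^G}(𝒴')/Z_{Ĥ^G}(𝒴')` is the conditional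
probability that no new edge is doubly occupied, which by `(GpropB)` is within `(1 ± δ)^N` of its
value `C_H B^{κ Cut(𝒴')}` under the product measures `Q^{𝒴'_x}` (`sum_patterns_portLaw`); finally
`(1 ± n^{-2θ})^N = 1 + o(1)` uniformly in `N ≤ n^{θ/4}`. This turns the bundled fact
`slyGadgetReduction` into a statement about Sly's Theorem 2.1 alone.
[cite: Sly2010, Lemma 2.2 (§2.2); GalanisStefankovicVigoda2016, §6.3 (proof sketch)] -/
theorem slyCutEstimate_of_slyProps {θ ε : ℝ} (hθ : 0 < θ) (hε : 0 < ε) {qp qm : ℝ} (hqm : 0 < qm)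
    (hlt : qm < qp) (hqp : qp < 1) :
    ∃ n₀ : ℕ, ∀ n : ℕ, n₀ ≤ n → ∀ {W : Type u} [Fintype W] [DecidableEq W] (G : SimpleGraph W)
      {lam : ℝ}, 0 ≤ lam → ∀ (Wp Wm : Finset W) {m : ℕ} (Vp Vm : Fin m ↪ W),
        SlyPropA G lam Wp Wm n → SlyPropB G lam Wp Wm Vp Vm qp qm ((n : ℝ) ^ (-(2 * θ))) →
          ∀ N κ : ℕ, (N : ℝ) ≤ (n : ℝ) ^ (θ / 4) → SlyCutEstimate G lam Wp Wm Vp Vm qp qm ε n θ N κ := by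
  obtain ⟨n₀, hn₀⟩ := SlyReduction.eventually_pow_error_le hθ hε
  refine ⟨n₀, fun n hn W _ _ G lam hlam Wp Wm m Vp Vm hA hB N κ hN ι H Y => ?_⟩
  obtain ⟨hnpos, hδ1, herr⟩ := hn₀ n hn
  obtain ⟨hlo, hhi⟩ := herr N hN
  have hnr : (0 : ℝ) < n := by exact_mod_cast hnpos
  constructor
  · -- (phaseProbs)
    refine le_trans ?_ (phaseProbs_of_slyPropA G Vp Vm ι hlam Wp Wm hA Y)
    have hpow : (n : ℝ) ^ (-((n : ℝ) ^ (θ / 4))) ≤ ((n : ℝ) ^ N)⁻¹ := by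
      rw [← Real.rpow_natCast, ← Real.rpow_neg hnr.le]
      exact Real.rpow_le_rpow_of_exponent_le (by exact_mod_cast hnpos) (neg_le_neg hN)
    calc (n : ℝ) ^ (-((n : ℝ) ^ (θ / 4))) * independencePolynomial (gadgetSubst ⊥ G Vp Vm ι) lam
        ≤ ((n : ℝ) ^ N)⁻¹ * independencePolynomial (gadgetSubst ⊥ G Vp Vm ι) lam :=
          mul_le_mul_of_nonneg_right hpow (independencePolynomial_pos (gadgetSubst ⊥ G Vp Vm ι) hlam).le
      _ = independencePolynomial (gadgetSubst ⊥ G Vp Vm ι) lam / (n : ℝ) ^ N := by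
          rw [div_eq_inv_mul]
  · -- (cutProb)
    obtain ⟨h1, h2⟩ := cutProb_bounds_of_slyPropB H G Vp Vm ι hlam Wp Wm hqm hlt hqp hδ1 hB Y
    have hB1 : (0 : ℝ) ≤ slyB qp qm := zero_le_one.trans (one_lt_slyB hqm hlt hqp).le
    have hX : 0 ≤ slyC qp qm κ H.edgeFinset.card * slyB qp qm ^ (κ * cutSize H Y) *
        hardcoreZOn (gadgetSubst ⊥ G Vp Vm ι) lam (fun I => phaseVec Wp Wm I = Y) :=
      mul_nonneg (mul_nonneg (slyC_pos hqm hlt hqp _ _).le (pow_nonneg hB1 _))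
        (hardcoreZOn_nonneg _ hlam _)
    rw [abs_sub_le_iff]
    constructor <;> nlinarith [mul_le_mul_of_nonneg_right hlo hX, mul_le_mul_of_nonneg_right hhi hX]

open scoped Classical in
/-- **What remains of `slyGadgetReduction` after Lemma 2.2: Sly's Theorem 2.1.** If for every
`Δ ≥ 3` and `λ > λ_c(𝕋_Δ)` there are a degree `d ∈ [3, Δ]` with `λ > λ_c(𝕋_d)`, constants
`θ ∈ (0, 1/8)`, `0 < q⁻ < q⁺ < 1` and, for all large `n`, SOME gadget `(G, W^{±}, V^{±})` on `≤ 3n`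
vertices of maximum degree `≤ d` with `2m` distinct ports of degree `≤ d - 1` (`m = slyM d θ n`)
satisfying `(GpropA)` and `(GpropB)` with `δ = n^{-2θ}` — the derandomised content of Sly 2010,
Theorem 2.1 (with GGŠVY Lemma 5 / Cor. 6 and GŠV16 Lemma 4 for the range of `(d, λ)`) — then the
bundled fact `slyGadgetReduction` holds: Lemma 2.2 (`slyCutEstimate_of_slyProps`) supplies
`SlyCutEstimate` for every `ε > 0`, all `N ≤ n^{θ/4}/(d-1) ≤ n^{θ/4}` and `κ = slyK θ n`.
[cite: Sly2010, Thm 2.1 and Lemma 2.2 (§2)] -/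
theorem slyGadgetReduction_of_gadgets
    (h21 : ∀ Δ : ℕ, 3 ≤ Δ → ∀ lam : ℝ, hardCoreThreshold Δ < lam →
      ∃ d : ℕ, 3 ≤ d ∧ d ≤ Δ ∧ hardCoreThreshold d < lam ∧
      ∃ θ qp qm : ℝ, 0 < θ ∧ θ < 1 / 8 ∧ 0 < qm ∧ qm < qp ∧ qp < 1 ∧
        ∃ n₁ : ℕ, ∀ n : ℕ, n₁ ≤ n →
          ∃ (v : ℕ) (G : SimpleGraph (Fin v)) (Wp Wm : Finset (Fin v))
            (Vp Vm : Fin (slyM d θ n) ↪ Fin v),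
            (v : ℝ) ≤ 3 * n ∧ G.maxDegree ≤ d ∧ Disjoint Wp Wm ∧
              Disjoint (Set.range Vp) (Set.range Vm) ∧
              (∀ i, G.degree (Vp i) ≤ d - 1) ∧ (∀ i, G.degree (Vm i) ≤ d - 1) ∧
              SlyPropA G lam Wp Wm n ∧
              SlyPropB G lam Wp Wm Vp Vm qp qm ((n : ℝ) ^ (-(2 * θ)))) :
    slyGadgetReduction := by
  intro Δ hΔ lam hlam
  obtain ⟨d, hd3, hdΔ, hdlam, θ, qp, qm, hθ, hθ8, hqm, hlt, hqp, n₁, hn₁⟩ := h21 Δ hΔ lam hlam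
  refine ⟨d, hd3, hdΔ, hdlam, θ, qp, qm, hθ, hθ8, hqm, hlt, hqp, fun ε hε => ?_⟩
  obtain ⟨n₀, hn₀⟩ := slyCutEstimate_of_slyProps hθ hε hqm hlt hqp
  refine ⟨max n₀ n₁, fun n hn => ?_⟩
  obtain ⟨v, G, Wp, Wm, Vp, Vm, hv, hdeg, hW, hVV, hdp, hdm, hA, hB⟩ := hn₁ n (le_of_max_le_right hn)
  have hlam0 : 0 ≤ lam := ((hardCoreThreshold_pos hd3).trans hdlam).le
  refine ⟨v, G, Wp, Wm, Vp, Vm, hv, hdeg, hW, hVV, hdp, hdm, hA, hB, fun N hN => ?_⟩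
  refine hn₀ n (le_of_max_le_left hn) G hlam0 Wp Wm Vp Vm hA hB N (slyK θ n) (hN.trans ?_)
  have hd1 : (1 : ℝ) ≤ (d : ℝ) - 1 := by
    have : (3 : ℝ) ≤ d := by exact_mod_cast hd3
    linarith
  exact div_le_self (Real.rpow_nonneg (Nat.cast_nonneg n) _) hd1

end Assembly

/-! ### Robustness of `(GpropB)` and the degree covering: what remains of the fact, per degree

`(GpropB)` is monotone in the error (`SlyPropB.mono`) and passes to sub-collections of ports
(`SlyPropB.restrict`: the marginal of the product measure `Q^{±}` on a sub-collection of ports is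
the product measure there, `SlyReduction.sum_portLaw_filter_trace`, and relative `L^∞` errors survive
summation over the fibres), so a gadget theorem printed with its own constant `θ'` and
`(d-1)^{⌊θ' log_{d-1} n⌋}` roots per side yields the tree's parameters for every smaller `θ` and
every larger error. Sly's Theorem 2.1 is in print per degree `d` on the following ranges of `λ` (his
Condition 1.2 verified there; his two extra inequalities are unnecessary, GGŠVY §2.4): `d = 3`, all
`λ > λ_c(𝕋_3) = 4` (Galanis–Ge–Štefankovič–Vigoda–Yang, Lemma 5); `d = 4, 5`, all `λ > λ_c(𝕋_d)`
(Galanis–Štefankovič–Vigoda 2016, Lemma 4 with §6 Lemma 19 — the same gadget, phase ties broken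
towards `−`); `d ≥ 6`, `λ_c(𝕋_d) < λ ≤ λ_{1/2}(𝕋_d)`, a range containing `(λ_c(𝕋_d), λ_c(𝕋_{d-1})]`
(GGŠVY Cor. 6). The least `d ≥ 3` with `λ > λ_c(𝕋_d)` is `≤ Δ` and has `d = 3` or
`λ ≤ λ_c(𝕋_{d-1})` (`exists_least_hardCoreDegree`, the covering used in both papers' proofs of their
Theorem 1), so gadgets on exactly these ranges give `slyGadgetReduction`
(`slyGadgetReduction_of_gadgetsAt`): what remains unproved of the fact is the derandomised
Theorem 2.1 / Lemma 19 at the pairs `(d, λ)` with `λ > λ_c(𝕋_d)` and `d = 3 ∨ λ ≤ λ_c(𝕋_{d-1})`. -/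

section PerDegree

variable {V : Type*} [Fintype V] [DecidableEq V]

/-- `(GpropB)` with error `δ` implies `(GpropB)` with any larger error `δ'` (for `λ ≥ 0` and
`q^{±} ∈ [0, 1]`, so that the reference weights `Q^{±}(S) · Z_G(λ; Y = ±)` are nonnegative). [folklore] -/
theorem SlyPropB.mono {G : SimpleGraph V} {lam : ℝ} (hlam : 0 ≤ lam) {Wp Wm : Finset V} {m : ℕ}
    {Vp Vm : Fin m ↪ V} {qp qm δ δ' : ℝ} (hqm : 0 ≤ qm) (hqm1 : qm ≤ 1) (hqp : 0 ≤ qp)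
    (hqp1 : qp ≤ 1) (hδ : δ ≤ δ') (h : SlyPropB G lam Wp Wm Vp Vm qp qm δ) :
    SlyPropB G lam Wp Wm Vp Vm qp qm δ' := by
  intro s S
  refine (h s S).trans (mul_le_mul_of_nonneg_right hδ (mul_nonneg ?_ (hardcoreZOn_nonneg G hlam _)))
  cases s
  · exact portLaw_nonneg hqm hqm1 hqp hqp1 m S
  · exact portLaw_nonneg hqp hqp1 hqm hqm1 m S

namespace SlyReduction

/-- **Partition of a restricted partition function by an observable**:
`Z_G(λ; E) = Σ_b Z_G(λ; E ∧ f = b)` for a finite-valued function `f` of the configuration. [folklore] -/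
theorem sum_hardcoreZOn_and_fiber (G : SimpleGraph V) (lam : ℝ) (E : Finset V → Prop) {β : Type*}
    [Fintype β] (f : Finset V → β) :
    ∑ b, hardcoreZOn G lam (fun I => E I ∧ f I = b) = hardcoreZOn G lam E := by
  classical
  simp only [hardcoreZOn_def]
  rw [Finset.sum_comm]
  refine Finset.sum_congr rfl fun I _ => ?_
  by_cases hI : G.IsIndepSet (↑I : Set V) <;> by_cases hE : E I <;>
    simp [hI, hE, Finset.sum_ite_eq]

omit [Fintype V] in
/-- The port configuration on a sub-collection of ports `e : Fin m ↪ Fin m'` is the trace along `e`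
of the port configuration on all `m'` ports. [folklore] -/
theorem portPattern_trans {m m' : ℕ} (e : Fin m ↪ Fin m') (Vp Vm : Fin m' ↪ V) (I : Finset V) :
    portPattern (e.trans Vp) (e.trans Vm) I =
      ((Finset.univ.filter fun i => e i ∈ (portPattern Vp Vm I).1),
        (Finset.univ.filter fun i => e i ∈ (portPattern Vp Vm I).2)) := by
  simp [portPattern, Function.Embedding.trans_apply]

/-- **Marginal of a homogeneous Bernoulli product measure on a sub-collection of coordinates**:
summing the weights `a^{|A|} (1-a)^{m'-|A|}` over the sets `A ⊆ Fin m'` with prescribed trace `T`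
along an embedding `e : Fin m ↪ Fin m'` gives `a^{|T|} (1-a)^{m-|T|}` (expand
`Π_c (p_c + q_c)` for occupied/vacant weights `p, q` killed on the forbidden/required ports). [folklore] -/
theorem sum_pow_mul_pow_filter_trace {m m' : ℕ} (e : Fin m ↪ Fin m') (a : ℝ) (T : Finset (Fin m)) :
    ∑ A : Finset (Fin m'), (if (Finset.univ.filter fun i => e i ∈ A) = T then
        a ^ A.card * (1 - a) ^ (m' - A.card) else 0) = a ^ T.card * (1 - a) ^ (m - T.card) := by
  classical
  -- occupied weight, killed on the images of `Tᶜ`; vacant weight, killed on the images of `T`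
  set p : Fin m' → ℝ := fun c => if c ∈ Tᶜ.map e then 0 else a with hp
  set q : Fin m' → ℝ := fun c => if c ∈ T.map e then 0 else 1 - a with hq
  have hexp := Fintype.prod_add p q
  -- the product side
  have hprod : ∏ c, (p c + q c) = a ^ T.card * (1 - a) ^ (m - T.card) := by
    rw [← Finset.prod_mul_prod_compl (Finset.univ.map e)]
    have h2 : ∏ c ∈ (Finset.univ.map e)ᶜ, (p c + q c) = 1 := by
      refine Finset.prod_eq_one fun c hc => ?_
      rw [Finset.mem_compl, Finset.mem_map] at hc
      push Not at hc
      have hc1 : c ∉ Tᶜ.map e := fun h' => by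
        obtain ⟨i, -, hi⟩ := Finset.mem_map.1 h'
        exact hc i (Finset.mem_univ _) hi
      have hc2 : c ∉ T.map e := fun h' => by
        obtain ⟨i, -, hi⟩ := Finset.mem_map.1 h'
        exact hc i (Finset.mem_univ _) hi
      rw [hp, hq]
      simp only [hc1, hc2, if_false]
      ring
    rw [h2, mul_one, Finset.prod_map]
    have h1 : ∀ i : Fin m, p (e i) + q (e i) = if i ∈ T then a else 1 - a := by
      intro i
      rw [hp, hq]
      simp only [Finset.mem_map', Finset.mem_compl]
      by_cases hi : i ∈ T <;> simp [hi]
    simp_rw [h1]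
    rw [← Finset.prod_mul_prod_compl T, Finset.prod_congr rfl fun i (hi : i ∈ T) => if_pos hi,
      Finset.prod_congr rfl fun i (hi : i ∈ Tᶜ) => if_neg (Finset.mem_compl.1 hi),
      Finset.prod_const, Finset.prod_const, Finset.card_compl, Fintype.card_fin]
  -- the sum side, termwise
  have hsum : ∀ A : Finset (Fin m'), (∏ c ∈ A, p c) * ∏ c ∈ Aᶜ, q c =
      if (Finset.univ.filter fun i => e i ∈ A) = T then a ^ A.card * (1 - a) ^ (m' - A.card) else 0 := by
    intro A
    split_ifs with hA
    · have hpA : ∀ c ∈ A, p c = a := by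
        intro c hc
        rw [hp]
        simp only
        rw [if_neg]
        intro h'
        obtain ⟨i, hi, rfl⟩ := Finset.mem_map.1 h'
        have : i ∈ T := by rw [← hA]; simpa using hc
        exact Finset.mem_compl.1 hi this
      have hqA : ∀ c ∈ Aᶜ, q c = 1 - a := by
        intro c hc
        rw [hq]
        simp only
        rw [if_neg]
        intro h'
        obtain ⟨i, hi, rfl⟩ := Finset.mem_map.1 h'
        rw [← hA] at hi
        exact Finset.mem_compl.1 hc (by simpa using hi)
      rw [Finset.prod_congr rfl hpA, Finset.prod_congr rfl hqA, Finset.prod_const, Finset.prod_const,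
        Finset.card_compl, Fintype.card_fin]
    · -- some port `e i` violates the prescribed trace: one of the two products vanishes
      have hex : ∃ i : Fin m, ¬ (e i ∈ A ↔ i ∈ T) := by
        by_contra hall
        push Not at hall
        exact hA (Finset.ext fun i => by simpa using hall i)
      obtain ⟨i, hi⟩ := hex
      by_cases hiA : e i ∈ A
      · have hiT : i ∉ T := fun h' => hi ⟨fun _ => h', fun _ => hiA⟩
        have hp0 : p (e i) = 0 := by
          rw [hp]
          simp only
          rw [if_pos (Finset.mem_map_of_mem e (Finset.mem_compl.2 hiT))]
        rw [Finset.prod_eq_zero hiA hp0, zero_mul]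
      · have hiT : i ∈ T := by
          by_contra h'
          exact hi ⟨fun h => absurd h hiA, fun h => absurd h h'⟩
        have hq0 : q (e i) = 0 := by
          rw [hq]
          simp only
          rw [if_pos (Finset.mem_map_of_mem e hiT)]
        rw [Finset.prod_eq_zero (Finset.mem_compl.2 hiA) hq0, mul_zero]
  rw [← hprod, hexp]
  exact Finset.sum_congr rfl fun A _ => (hsum A).symm

/-- **Marginal of `Q_V^{±}` on a sub-collection of ports**: summing `portLaw a b m' S'` over the port
configurations `S'` on `m'` ports per side whose trace along `e : Fin m ↪ Fin m'` is `S` gives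
`portLaw a b m S` (the product measure with the same parameters on the sub-collection). [folklore] -/
theorem sum_portLaw_filter_trace {m m' : ℕ} (e : Fin m ↪ Fin m') (a b : ℝ)
    (S : Finset (Fin m) × Finset (Fin m)) :
    ∑ S' : Finset (Fin m') × Finset (Fin m'),
      (if ((Finset.univ.filter fun i => e i ∈ S'.1), (Finset.univ.filter fun i => e i ∈ S'.2)) = S
        then portLaw a b m' S' else 0) = portLaw a b m S := by
  classical
  rw [Fintype.sum_prod_type]
  simp only [portLaw]
  rw [← sum_pow_mul_pow_filter_trace e a S.1, ← sum_pow_mul_pow_filter_trace e b S.2,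
    Finset.sum_mul_sum]
  refine Finset.sum_congr rfl fun A _ => Finset.sum_congr rfl fun B _ => ?_
  by_cases hA : (Finset.univ.filter fun i => e i ∈ A) = S.1 <;>
    by_cases hB : (Finset.univ.filter fun i => e i ∈ B) = S.2 <;>
    simp [hA, hB, Prod.ext_iff]

end SlyReduction

/-- **`(GpropB)` passes to sub-collections of ports.** If the port configuration on `2m'` ports is,
conditionally on each phase, within relative `L^∞` error `δ` of the product measure `Q^{±}`, then so
is the port configuration on the sub-collections `V⁺ ∘ e`, `V⁻ ∘ e` of `2m` ports, for any
`e : Fin m ↪ Fin m'`: the conditional law of the trace is the sum over the fibre, the product measure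
marginalises to the product measure (`SlyReduction.sum_portLaw_filter_trace`), and
`|Σ (a_i - b_i)| ≤ Σ |a_i - b_i| ≤ δ Σ b_i`. (This is what lets a gadget with
`(d-1)^{⌊θ' log_{d-1} n⌋}` roots per side serve as the tree's gadget for every `θ ≤ θ'`: the unused
roots become ordinary vertices of degree `d - 1`.) [folklore] -/
theorem SlyPropB.restrict {G : SimpleGraph V} {lam : ℝ} {Wp Wm : Finset V} {m m' : ℕ}
    {Vp Vm : Fin m' ↪ V} {qp qm δ : ℝ} (h : SlyPropB G lam Wp Wm Vp Vm qp qm δ)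
    (e : Fin m ↪ Fin m') : SlyPropB G lam Wp Wm (e.trans Vp) (e.trans Vm) qp qm δ := by
  classical
  intro s S
  set a : ℝ := (if s then qp else qm) with ha
  set b : ℝ := (if s then qm else qp) with hb
  set F : Finset (Finset (Fin m') × Finset (Fin m')) := Finset.univ.filter fun S' =>
    ((Finset.univ.filter fun i => e i ∈ S'.1), (Finset.univ.filter fun i => e i ∈ S'.2)) = S with hF
  -- (i) the partition function of the trace event is the sum over the fibre
  have hZ : hardcoreZOn G lam
        (fun I => slyPhase Wp Wm I = s ∧ portPattern (e.trans Vp) (e.trans Vm) I = S) =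
      ∑ S' ∈ F, hardcoreZOn G lam (fun I => slyPhase Wp Wm I = s ∧ portPattern Vp Vm I = S') := by
    rw [hF, Finset.sum_filter, ← SlyReduction.sum_hardcoreZOn_and_fiber G lam
      (fun I => slyPhase Wp Wm I = s ∧ portPattern (e.trans Vp) (e.trans Vm) I = S) (portPattern Vp Vm)]
    refine Finset.sum_congr rfl fun S' _ => ?_
    split_ifs with hS'
    · congr 1
      funext I
      apply propext
      rw [SlyReduction.portPattern_trans]
      constructor
      · rintro ⟨⟨h1, -⟩, h3⟩
        exact ⟨h1, h3⟩
      · rintro ⟨h1, h3⟩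
        refine ⟨⟨h1, ?_⟩, h3⟩
        rw [h3]
        exact hS'
    · rw [hardcoreZOn_def]
      refine Finset.sum_eq_zero fun I _ => if_neg ?_
      rintro ⟨-, ⟨-, h2⟩, h3⟩
      apply hS'
      rw [← h3, ← SlyReduction.portPattern_trans]
      exact h2
  -- (ii) the product measure marginalises to the product measure
  have hQ : portLaw a b m S = ∑ S' ∈ F, portLaw a b m' S' := by
    rw [hF, Finset.sum_filter]
    exact (SlyReduction.sum_portLaw_filter_trace e a b S).symm
  -- (iii) sum the fibrewise estimates
  rw [hZ, hQ, Finset.sum_mul, ← Finset.sum_sub_distrib, Finset.mul_sum]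
  refine (Finset.abs_sum_le_sum_abs _ _).trans (Finset.sum_le_sum fun S' _ => ?_)
  exact h s S'

/-- **Least admissible degree** (the covering behind the range of `(d, λ)` in `slyGadgetReduction`):
for `Δ ≥ 3` and `λ > λ_c(𝕋_Δ)`, the least `d ≥ 3` with `λ > λ_c(𝕋_d)` is `≤ Δ` and has `d = 3` or
`λ ≤ λ_c(𝕋_{d-1})` — so `(d, λ)` lies in one of the ranges on which Sly's gadget theorem is in print
(`d = 3`: all `λ > 4`; `d = 4, 5`: all of non-uniqueness; `d ≥ 6`: `(λ_c(𝕋_d), λ_c(𝕋_{d-1})]`), the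
covering by which GGŠVY (§2.4) and GŠV16 (§6) prove their Theorem 1 at every degree.
[cite: GalanisEtAl2012, §2.4 (proof of Thm 1)] -/
theorem exists_least_hardCoreDegree {Δ : ℕ} (hΔ : 3 ≤ Δ) {lam : ℝ} (hlam : hardCoreThreshold Δ < lam) :
    ∃ d : ℕ, 3 ≤ d ∧ d ≤ Δ ∧ hardCoreThreshold d < lam ∧
      (d = 3 ∨ lam ≤ hardCoreThreshold (d - 1)) := by
  classical
  have hex : ∃ d : ℕ, 3 ≤ d ∧ hardCoreThreshold d < lam := ⟨Δ, hΔ, hlam⟩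
  refine ⟨Nat.find hex, (Nat.find_spec hex).1, Nat.find_min' hex ⟨hΔ, hlam⟩, (Nat.find_spec hex).2, ?_⟩
  by_cases h3 : Nat.find hex = 3
  · exact Or.inl h3
  · refine Or.inr (not_lt.1 fun hlt => ?_)
    have h3' : 3 ≤ Nat.find hex := (Nat.find_spec hex).1
    exact Nat.find_min hex (show Nat.find hex - 1 < Nat.find hex by omega) ⟨by omega, hlt⟩

open scoped Classical in
/-- **`slyGadgetReduction` from the per-degree gadget theorems in print.** If for every `d ≥ 3` and
every `λ > λ_c(𝕋_d)` with `d = 3` or `λ ≤ λ_c(𝕋_{d-1})` — the ranges covered by Sly 2010 Thm 2.1 with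
GGŠVY Lemma 5 (`d = 3`), GŠV16 Lemma 4 + Lemma 19 (`d = 4, 5`) and GGŠVY Cor. 6 (`d ≥ 6`) — there are
constants `θ ∈ (0, 1/8)`, `0 < q⁻ < q⁺ < 1` and, for all large `n`, SOME degree-`d` gadget on `≤ 3n`
vertices with `2m` distinct ports of degree `≤ d - 1` (`m = slyM d θ n`) satisfying `(GpropA)` and
`(GpropB)` with `δ = n^{-2θ}` (the derandomised content of those theorems), then `slyGadgetReduction`
holds: choose the least admissible degree (`exists_least_hardCoreDegree`) and apply Lemma 2.2
(`slyGadgetReduction_of_gadgets`).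
[cite: Sly2010, Thm 2.1 (§2.1); GalanisEtAl2012 Lemma 5, Cor. 6, §2.4; GalanisStefankovicVigoda2016 Lemma 4, §6 Lemma 19] -/
theorem slyGadgetReduction_of_gadgetsAt
    (h : ∀ d : ℕ, 3 ≤ d → ∀ lam : ℝ, hardCoreThreshold d < lam →
      (d = 3 ∨ lam ≤ hardCoreThreshold (d - 1)) →
      ∃ θ qp qm : ℝ, 0 < θ ∧ θ < 1 / 8 ∧ 0 < qm ∧ qm < qp ∧ qp < 1 ∧
        ∃ n₁ : ℕ, ∀ n : ℕ, n₁ ≤ n →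
          ∃ (v : ℕ) (G : SimpleGraph (Fin v)) (Wp Wm : Finset (Fin v))
            (Vp Vm : Fin (slyM d θ n) ↪ Fin v),
            (v : ℝ) ≤ 3 * n ∧ G.maxDegree ≤ d ∧ Disjoint Wp Wm ∧
              Disjoint (Set.range Vp) (Set.range Vm) ∧
              (∀ i, G.degree (Vp i) ≤ d - 1) ∧ (∀ i, G.degree (Vm i) ≤ d - 1) ∧
              SlyPropA G lam Wp Wm n ∧
              SlyPropB G lam Wp Wm Vp Vm qp qm ((n : ℝ) ^ (-(2 * θ)))) :
    slyGadgetReduction := by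
  refine slyGadgetReduction_of_gadgets fun Δ hΔ lam hlam => ?_
  obtain ⟨d, hd3, hdΔ, hdlam, hcov⟩ := exists_least_hardCoreDegree hΔ hlam
  exact ⟨d, hd3, hdΔ, hdlam, h d hd3 lam hdlam hcov⟩

end PerDegree


end Literature.Computability.Complexity
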